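import Literature.Probability.LatticeModels.PercolationPolygonWord
import HarnessLib

/-!
# Row-transfer exactness: the crossing probability of a lattice polygon is its word amplitude

Discharge of the named fact `Literature.Probability.LatticeModels.RowTransferExactness` of
`Literature.Probability.LatticeModels.PercolationPolygonWord`: for a conformal rectangle whose
carrier is an open polyomino of `δ₀`-squares (`polyominoCarrier δ₀ s`), at every aligned mesh
`δ = δ₀ / N` the G02 crossing probability `Percolation.bondDomainCrossingProb R δ` of bond
percolation on `ℤ²` at `p = 1/2` equals the transfer-matrix word amplitude
`polygonWordAmplitude R δ` (`RowTransferExactness_holds`, at the end of the file).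

This is the finite-lattice bookkeeping behind "the crossing probability is a matrix element of a
product of transfer matrices between boundary states" (Cardy, *Conformal invariance and
percolation*, arXiv:math-ph/0103018, §7.1, `P = ⟨a| e^{-WH} |b⟩`; Bondesan–Jacobsen–Saleur,
Nucl. Phys. B 867 (2013), arXiv:1207.7005, §5, lattice amplitudes `⟨B| T^{L'} |B'⟩`); the
precise identity for the G02 discretisation has no single printed source and is proved here from
scratch, following the proof sketch recorded in the docstring of `RowTransferExactness`.
Everything lives in `namespace Literature.Probability.LatticeModels.RowTransfer` except the
final theorem.

## The argument

Fix a finite vertex set `V ⊆ ℤ²`, wire sets `W_A, W_B ⊆ ℤ²` and a base row `b`; write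
`S_y = rowCols V y` for the columns of row `y` and `ω ⊆ Sym2 (Site 2)` for a bond configuration.

* **Setoid lemmas** (`pairSetoid`, the setoid joining two points — the expression of `joinTwo₂`
  on an arbitrary type; `comap_sup_pairs`: restricting along `f` the join of a setoid `R` with
  classes generated by pairs *of image points* is the join of the restriction of `R` with the
  classes generated by the pairs; `comap_sup_vert_eq_vertRel₂`: the vertical layer `vertRel₂`
  is the restriction to the new row of the join of `R` with the open vertical edges, when the new
  row's sites are `R`-singletons). Both are proved by exhibiting an explicit equivalence relation
  above the generators.
* **The row state as a random variable** (`partRec V W_A W_B b ω n : RowState₂ (S_{b+n})`):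
  the state of row `b + n` obtained from the free state on row `b` by the deterministic row maps
  `rowMap` (restrict–insert–vertical–horizontal–wire, the map averaged by the letter
  `rowLetter`) fed with the open vertical edges `openVert ω` and open horizontal edges
  `openHoriz ω` of the rows `b + 1, …, b + n`.
* **The invariant** (`partRec_rel`): `(partRec … ω n).rel` is the restriction to row `b + n`
  (embedded with the two stars into `APoint = Site 2 ⊕ Fin 2` by `emb`) of the *augmented
  relation* `augRel … ω n`, the classes of `APoint` generated by the open edges of `V` in the rows
  `≤ b + n` and the wires of those rows to the stars (`vertGen`, `horizGen`, `wireGen`).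
* **Connectivity** (`augRel_iff_reachable`, `reachable_stars_iff`): when the rows of `V` lie in
  `(b, b + N]`, `augRel … N` is reachability in the augmented graph `augGraph` (open subgraph of
  `ℤ²` induced on `V` plus an edge from each vertex of `V ∩ W_A` to `⋆_A`, of `V ∩ W_B` to
  `⋆_B`), and the two stars are joined there iff some vertex of `V ∩ W_A` is joined to some
  vertex of `V ∩ W_B` by an open path inside `V` (a path between the stars has only sites in its
  interior).
* **The law** (`prob_partEvent`): `P_{1/2}(partRec … n = π) = latticeWordDist … n π`, by
  induction over the rows carrying a spectator cylinder event (`prob_partEvent_inter_boxEvent`);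
  independence enters only through the cylinder marginal of Mathlib's `setBernoulli`,
  `prob_boxEvent`: `P_{1/2}(ω ∩ E = A) = 2^{-|E|}` for a finite set `E` of edges of `ℤ²`
  (`Measure.infinitePi_pi`). The letter is the average of the push-forwards along the row maps
  (`rowLetter_eq`); the phantom vertical slots drawn by `T_{S'}` below freshly inserted columns
  are genuine (irrelevant) edges of `ℤ²` one row down, so the edge sets of distinct rows
  (`rowEdges`, `pastEdges`) are disjoint and every letter contributes the factor
  `2^{-|S'|-|hEdges S'|}`.
* **Assembly** (`discreteCrossing_polyomino_eq`, `RowTransferExactness_holds`): at an aligned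
  mesh `Ω_δ` is the subgraph of `ℤ²` induced on `meshDomain`
  (`discreteDomainGraph_adj_iff_polyomino`), the discrete arcs lie in `meshDomain`, and all rows
  of `meshDomainFinset` lie in `(wordBaseRow, wordBaseRow + wordRowCount]`
  (`wordBaseRow_lt_and_le`), so G02's event `discreteCrossing` is "stars joined" at the top row
  and its probability is the word amplitude (`prob_starsJoined`).

Design notes. Distributions are row vectors as in the two definition files; `statePushforward`
is unfolded pointwise (`statePushforward_apply`, `statePushforward_comp`). No planarity and no
spectral theory is used or proved here. Mathlib anchors: `Setoid.comap`, `Setoid.ker`, the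
complete lattice of setoids, `SimpleGraph.fromRel`, `SimpleGraph.Reachable`, `SimpleGraph.Walk`,
`ProbabilityTheory.setBernoulli` (`setBernoulli_apply'`), `MeasureTheory.Measure.infinitePi_pi`,
`MeasureTheory.sum_measureReal_preimage_singleton`.
-/

noncomputable section

open Finset
open scoped Classical

namespace Literature.Probability.LatticeModels

open Literature.Probability.Percolation

namespace RowTransfer

section SetoidLemmas

variable {α β γ : Type*}

/-- The setoid joining exactly the two points `a` and `b` (all other classes singletons); the
same expression as `joinTwo₂`, on an arbitrary type. [folklore] -/
def pairSetoid [DecidableEq α] (a b : α) : Setoid α :=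
  Setoid.ker fun c => if c = b then a else c

/-- `pairSetoid a b` relates `a` and `b`. [folklore] -/
theorem pairSetoid_rel [DecidableEq α] (a b : α) : pairSetoid a b a b := by
  rw [pairSetoid, Setoid.ker_def]
  simp

/-- `pairSetoid a b` is below a setoid `Q` iff `Q` relates `a` and `b`. [folklore] -/
theorem pairSetoid_le_iff [DecidableEq α] {a b : α} {Q : Setoid α} :
    pairSetoid a b ≤ Q ↔ Q a b := by
  constructor
  · intro h
    exact h (pairSetoid_rel a b)
  · intro hab
    rw [Setoid.le_def]
    intro c d hcd
    rw [pairSetoid, Setoid.ker_def] at hcd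
    by_cases hc : c = b <;> by_cases hd : d = b
    · rw [hc, hd]
    · rw [if_pos hc, if_neg hd] at hcd
      rw [hc, ← hcd]
      exact Q.symm' hab
    · rw [if_neg hc, if_pos hd] at hcd
      rw [hcd, hd]
      exact hab
    · rw [if_neg hc, if_neg hd] at hcd
      rw [hcd]

/-- `pairSetoid a a` is the trivial setoid. [folklore] -/
theorem pairSetoid_self [DecidableEq α] (a : α) : pairSetoid a a = ⊥ := by
  have h : (fun c : α => if c = a then a else c) = id := by
    funext c
    by_cases hc : c = a <;> simp [hc]
  rw [pairSetoid, h]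
  exact (Setoid.injective_iff_ker_bot _).1 Function.injective_id

/-- `joinTwo₂` is `pairSetoid`. [folklore] -/
theorem joinTwo₂_eq_pairSetoid {S : Finset ℤ} (a c : RowPoint₂ S) : joinTwo₂ a c = pairSetoid a c :=
  rfl

/-- The relation `x = y ∨ (P x ∧ P y)` (collapse the set `{P}` to one class) is an equivalence
relation. [folklore] -/
def collapseSetoid (P : α → Prop) : Setoid α where
  r x y := x = y ∨ (P x ∧ P y)
  iseqv :=
    { refl := fun _ => Or.inl rfl
      symm := fun h => h.elim (fun h => Or.inl h.symm) fun h => Or.inr ⟨h.2, h.1⟩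
      trans := by
        rintro x y z (rfl | ⟨hx, hy⟩) h2
        · exact h2
        · rcases h2 with rfl | ⟨-, hz⟩
          · exact Or.inr ⟨hx, hy⟩
          · exact Or.inr ⟨hx, hz⟩ }

/-- **Edges among tracked points commute with restriction.** For any setoid `R` on `α`, any map
`f : β → α` and any finite family of pairs `(u c, v c)` of points of `β`: restricting along `f`
the join of `R` with the classes generated by the image pairs `(f (u c), f (v c))` gives the join
of the restriction of `R` with the classes generated by the pairs themselves. (A chain of `R`-steps
and generator steps between two image points breaks at image points.) [folklore] -/
theorem comap_sup_pairs [DecidableEq α] [DecidableEq β] (f : β → α) (R : Setoid α) (s : Finset γ)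
    (u v : γ → β) :
    Setoid.comap f (R ⊔ s.sup fun c => pairSetoid (f (u c)) (f (v c))) =
      Setoid.comap f R ⊔ s.sup fun c => pairSetoid (u c) (v c) := by
  set P : Setoid β := Setoid.comap f R ⊔ s.sup fun c => pairSetoid (u c) (v c) with hP
  apply le_antisymm
  · -- an explicit equivalence relation above `R` and the generators
    let Q : Setoid α :=
      { r := fun x x' => R x x' ∨ ∃ a a', R x (f a) ∧ P a a' ∧ R (f a') x'
        iseqv :=
          { refl := fun x => Or.inl (R.refl' x)
            symm := by
              rintro x x' (h | ⟨a, a', h1, h2, h3⟩)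
              · exact Or.inl (R.symm' h)
              · exact Or.inr ⟨a', a, R.symm' h3, P.symm' h2, R.symm' h1⟩
            trans := by
              rintro x x' x'' (h | ⟨a, a', h1, h2, h3⟩) (h' | ⟨c, c', h1', h2', h3'⟩)
              · exact Or.inl (R.trans' h h')
              · exact Or.inr ⟨c, c', R.trans' h h1', h2', h3'⟩
              · exact Or.inr ⟨a, a', h1, h2, R.trans' h3 h'⟩
              · refine Or.inr ⟨a, c', h1, ?_, h3'⟩
                have hmid : P a' c := by
                  have : Setoid.comap f R a' c := by
                    rw [Setoid.comap_rel]
                    exact R.trans' h3 h1'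
                  exact (le_sup_left : Setoid.comap f R ≤ P) this
                exact P.trans' (P.trans' h2 hmid) h2' } }
    have hRQ : R ≤ Q := fun x x' h => Or.inl h
    have hTQ : (s.sup fun c => pairSetoid (f (u c)) (f (v c))) ≤ Q := by
      refine Finset.sup_le fun c hc => pairSetoid_le_iff.2 ?_
      refine Or.inr ⟨u c, v c, R.refl' _, ?_, R.refl' _⟩
      have h1 : pairSetoid (u c) (v c) ≤ s.sup fun c => pairSetoid (u c) (v c) :=
        Finset.le_sup (f := fun c => pairSetoid (u c) (v c)) hc
      exact (le_sup_right : (s.sup fun c => pairSetoid (u c) (v c)) ≤ P) (h1 (pairSetoid_rel _ _))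
    intro a b hab
    rw [Setoid.comap_rel] at hab
    have hQ : Q (f a) (f b) := (sup_le hRQ hTQ) hab
    rcases hQ with h | ⟨c, c', h1, h2, h3⟩
    · exact (le_sup_left : Setoid.comap f R ≤ P) (show Setoid.comap f R a b from h)
    · have h1' : P a c := (le_sup_left : Setoid.comap f R ≤ P) (show Setoid.comap f R a c from h1)
      have h3' : P c' b := (le_sup_left : Setoid.comap f R ≤ P) (show Setoid.comap f R c' b from h3)
      exact P.trans' (P.trans' h1' h2) h3'
  · apply sup_le
    · intro a b h
      rw [Setoid.comap_rel] at h ⊢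
      exact (le_sup_left : R ≤ R ⊔ _) h
    · refine Finset.sup_le fun c hc => pairSetoid_le_iff.2 ?_
      rw [Setoid.comap_rel]
      refine (le_sup_right : _ ≤ R ⊔ _) ?_
      have h1 : pairSetoid (f (u c)) (f (v c)) ≤ s.sup fun c => pairSetoid (f (u c)) (f (v c)) :=
        Finset.le_sup (f := fun c => pairSetoid (f (u c)) (f (v c))) hc
      exact h1 (pairSetoid_rel _ _)

end SetoidLemmas

/-! ### The vertical layer: old row, new row, and the vertical edges between them -/

section Vertical

variable {X : Type*} [DecidableEq X] {S S' : Finset ℤ}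

/-- **The vertical-layer lemma.** Let `R` be a setoid on a type `X` into which the old row
`S ⊔ {⋆_A, ⋆_B}` is embedded by `g` and the new row `S' ⊔ {⋆_A, ⋆_B}` by `f` (injective, same
stars, new sites distinct from old points and singletons of `R`). Join `R` with the classes
generated by the open vertical edges `(d x, f x)`, `x ∈ O`, where `d x` is the old site below `x`
(and `d x = f x`, a trivial generator, for the phantom columns `x ∉ S`). Then the partition
induced on the new row is `vertRel₂ O` applied to the old row's partition restricted to
`S ∩ S'` and inserted into `S'`. [folklore] -/
theorem comap_sup_vert_eq_vertRel₂ (f : RowPoint₂ S' → X) (g : RowPoint₂ S → X) (R : Setoid X)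
    (O : Finset S') (d : S' → X) (hf : Function.Injective f)
    (hstar : ∀ i, f (Sum.inr i) = g (Sum.inr i))
    (hnew : ∀ (x : S') (z : X), R (f (Sum.inl x)) z → z = f (Sum.inl x))
    (hfg : ∀ (x : S') (p : RowPoint₂ S), f (Sum.inl x) ≠ g p)
    (hdS : ∀ (x : S') (hx : (x : ℤ) ∈ S), d x = g (Sum.inl ⟨x, hx⟩))
    (hdnS : ∀ x : S', (x : ℤ) ∉ S → d x = f (Sum.inl x)) :
    Setoid.comap f (R ⊔ O.sup fun x => pairSetoid (d x) (f (Sum.inl x))) =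
      vertRel₂ O (insertRel₂ (Finset.inter_subset_right : S ∩ S' ⊆ S')
        (restrictRel₂ (Finset.inter_subset_left : S ∩ S' ⊆ S) (Setoid.comap g R))) := by
  set h₁ : S ∩ S' ⊆ S := Finset.inter_subset_left with hh₁
  set h₂ : S ∩ S' ⊆ S' := Finset.inter_subset_right with hh₂
  set Vr : Setoid X := O.sup fun x => pairSetoid (d x) (f (Sum.inl x)) with hVr
  -- bookkeeping on new sites
  have hnotnew_g : ∀ (p : RowPoint₂ S) (x : S'), f (Sum.inl x) ≠ g p := fun p x => hfg x p
  have hnotnew_star : ∀ (i : Fin 2) (x : S'), f (Sum.inl x) ≠ f (Sum.inr i) := by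
    intro i x h
    exact Sum.inl_ne_inr (hf h)
  apply le_antisymm
  · -- `Good z`: `z` is not a closed (or phantom) new site; `ρ z`: the old point standing for `z`
    let Good : X → Prop := fun z => ∀ x : S', z = f (Sum.inl x) → x ∈ O ∧ (x : ℤ) ∈ S
    have hGood_of_ne : ∀ z, (∀ x : S', f (Sum.inl x) ≠ z) → Good z :=
      fun z hz x hx => absurd hx.symm (hz x)
    have hGood_new : ∀ x : S', Good (f (Sum.inl x)) ↔ x ∈ O ∧ (x : ℤ) ∈ S := by
      intro x
      constructor
      · exact fun h => h x rfl
      · intro h x' hx'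
        obtain rfl : x = x' := Sum.inl_injective (hf hx')
        exact h
    let ρ : X → X := fun z =>
      if h : ∃ x : S', (x ∈ O ∧ (x : ℤ) ∈ S) ∧ f (Sum.inl x) = z then
        g (Sum.inl ⟨h.choose, h.choose_spec.1.2⟩) else z
    have hρ_of_ne : ∀ z, (∀ x : S', f (Sum.inl x) ≠ z) → ρ z = z := by
      intro z hz
      simp only [ρ]
      rw [dif_neg]
      rintro ⟨x, -, hx⟩
      exact hz x hx
    have hρ_new : ∀ (x : S') (hO : x ∈ O) (hx : (x : ℤ) ∈ S),
        ρ (f (Sum.inl x)) = g (Sum.inl ⟨x, hx⟩) := by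
      intro x hO hx
      have hex : ∃ x' : S', (x' ∈ O ∧ (x' : ℤ) ∈ S) ∧ f (Sum.inl x') = f (Sum.inl x) :=
        ⟨x, ⟨hO, hx⟩, rfl⟩
      simp only [ρ]
      rw [dif_pos hex]
      have e : hex.choose = x := Sum.inl_injective (hf hex.choose_spec.2)
      have e' : (hex.choose : ℤ) = (x : ℤ) := congrArg Subtype.val e
      congr 2
      exact Subtype.ext e'
    let Q : Setoid X :=
      { r := fun z z' => z = z' ∨ (Good z ∧ Good z' ∧ R (ρ z) (ρ z'))
        iseqv :=
          { refl := fun _ => Or.inl rfl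
            symm := by
              rintro z z' (rfl | ⟨h1, h2, h3⟩)
              · exact Or.inl rfl
              · exact Or.inr ⟨h2, h1, R.symm' h3⟩
            trans := by
              rintro z z' z'' (rfl | ⟨h1, h2, h3⟩) h'
              · exact h'
              · rcases h' with rfl | ⟨-, h2', h3'⟩
                · exact Or.inr ⟨h1, h2, h3⟩
                · exact Or.inr ⟨h1, h2', R.trans' h3 h3'⟩ } }
    have hRQ : R ≤ Q := by
      intro z z' hzz'
      by_cases hz : ∃ x : S', f (Sum.inl x) = z
      · obtain ⟨x, rfl⟩ := hz
        exact Or.inl (hnew x z' hzz').symm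
      by_cases hz' : ∃ x : S', f (Sum.inl x) = z'
      · obtain ⟨x, rfl⟩ := hz'
        exact Or.inl (hnew x z (R.symm' hzz'))
      push Not at hz hz'
      refine Or.inr ⟨hGood_of_ne z hz, hGood_of_ne z' hz', ?_⟩
      rw [hρ_of_ne z hz, hρ_of_ne z' hz']
      exact hzz'
    have hVQ : Vr ≤ Q := by
      refine Finset.sup_le fun x hO => pairSetoid_le_iff.2 ?_
      by_cases hx : (x : ℤ) ∈ S
      · rw [hdS x hx]
        refine Or.inr ⟨hGood_of_ne _ (hnotnew_g _), (hGood_new x).2 ⟨hO, hx⟩, ?_⟩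
        rw [hρ_of_ne _ (hnotnew_g _), hρ_new x hO hx]
      · -- a phantom column: the generator is trivial
        rw [hdnS x hx]
    -- the old point standing for a good new-row point
    have helper : ∀ a : RowPoint₂ S', Good (f a) → IsUp₂ O a ∧
        ∃ a' : RowPoint₂ (S ∩ S'), RowPoint₂.incl h₂ a' = a ∧ ρ (f a) = g (RowPoint₂.incl h₁ a') := by
      rintro (x | i) hg
      · obtain ⟨hO, hx⟩ := (hGood_new x).1 hg
        refine ⟨hO, Sum.inl ⟨x, Finset.mem_inter.2 ⟨hx, x.2⟩⟩, rfl, ?_⟩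
        rw [hρ_new x hO hx]
        rfl
      · refine ⟨trivial, Sum.inr i, rfl, ?_⟩
        rw [hρ_of_ne _ (hnotnew_star i), hstar]
        rfl
    intro a b hab
    rw [Setoid.comap_rel] at hab
    have hQ : Q (f a) (f b) := (sup_le hRQ hVQ) hab
    rcases hQ with h | ⟨hga, hgb, hR⟩
    · obtain rfl := hf h
      exact Or.inl rfl
    · obtain ⟨hua, a', ha', hρa⟩ := helper a hga
      obtain ⟨hub, b', hb', hρb⟩ := helper b hgb
      rw [vertRel₂_apply]
      refine Or.inr ⟨hua, hub, Or.inr ⟨a', b', ha', hb', ?_⟩⟩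
      change R (g (RowPoint₂.incl h₁ a')) (g (RowPoint₂.incl h₁ b'))
      rw [← hρa, ← hρb]
      exact hR
  · -- the easy inclusion: a vertical edge, an `R`-chain in the old row, a vertical edge
    have key : ∀ a' : RowPoint₂ (S ∩ S'), IsUp₂ O (RowPoint₂.incl h₂ a') →
        (R ⊔ Vr) (f (RowPoint₂.incl h₂ a')) (g (RowPoint₂.incl h₁ a')) := by
      rintro (⟨x, hx⟩ | i) hup
      · have hO : (⟨x, h₂ hx⟩ : S') ∈ O := hup
        have hxS : x ∈ S := h₁ hx
        have hgen : Vr (d ⟨x, h₂ hx⟩) (f (Sum.inl ⟨x, h₂ hx⟩)) :=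
          (Finset.le_sup (f := fun x => pairSetoid (d x) (f (Sum.inl x))) hO) (pairSetoid_rel _ _)
        rw [hdS ⟨x, h₂ hx⟩ hxS] at hgen
        exact (le_sup_right : Vr ≤ R ⊔ Vr) (Vr.symm' hgen)
      · change (R ⊔ Vr) (f (Sum.inr i)) (g (Sum.inr i))
        rw [hstar]
    intro a b hab
    rw [Setoid.comap_rel]
    rw [vertRel₂_apply] at hab
    rcases hab with rfl | ⟨hua, hub, hπ⟩
    · exact Setoid.refl' _ _
    · rcases hπ with hab | ⟨a', b', rfl, rfl, hab'⟩
      · rw [hab]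
      · change R (g (RowPoint₂.incl h₁ a')) (g (RowPoint₂.incl h₁ b')) at hab'
        exact Setoid.trans' _ (key a' hua)
          (Setoid.trans' _ ((le_sup_left : R ≤ R ⊔ Vr) hab') (Setoid.symm' _ (key b' hub)))

end Vertical

/-! ### Rows of a finite vertex set: embeddings, edges, the recursive row state -/

section RowData

/-- The points of all rows at once: the sites of `ℤ²` together with the two stars. [folklore] -/
abbrev APoint : Type := Site 2 ⊕ Fin 2

/-- The embedding of the two-star row points over the columns `S` of row `y` into `APoint`:
the column `x` goes to the site `(x, y)`, the stars to the stars. [folklore] -/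
def emb (S : Finset ℤ) (y : ℤ) : RowPoint₂ S → APoint
  | Sum.inl x => Sum.inl ![(x : ℤ), y]
  | Sum.inr i => Sum.inr i

/-- `emb` is injective. [folklore] -/
theorem emb_injective (S : Finset ℤ) (y : ℤ) : Function.Injective (emb S y) := by
  rintro (x | i) (x' | i') h
  · simp only [emb, Sum.inl.injEq] at h
    have h0 := congrFun h 0
    simp only [Matrix.cons_val_zero] at h0
    exact congrArg Sum.inl (Subtype.ext h0)
  · simp [emb] at h
  · simp [emb] at h
  · simp only [emb, Sum.inr.injEq] at h
    rw [h]

/-- The vertical edge of `ℤ²` between `(x, y')` and `(x, y)` (used with `y' = y - 1`: the edge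
below column `x` of row `y`). [folklore] -/
def vEdge (y' y x : ℤ) : Sym2 (Site 2) := s(![x, y'], ![x, y])

/-- The horizontal edge of `ℤ²` between `(x, y)` and `(x + 1, y)`. [folklore] -/
def hEdge (y x : ℤ) : Sym2 (Site 2) := s(![x, y], ![x + 1, y])

/-- The columns of row `y` (column set `S'`) whose vertical edge towards row `y'` is open in
`ω`. [folklore] -/
def openVert (ω : BondConfig (Site 2)) (S' : Finset ℤ) (y' y : ℤ) : Finset S' :=
  univ.filter fun x => vEdge y' y x ∈ ω

/-- The horizontal edges `{x, x + 1}` of row `y` (both columns in `S'`) that are open in `ω`.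
[folklore] -/
def openHoriz (ω : BondConfig (Site 2)) (S' : Finset ℤ) (y : ℤ) : Finset S' :=
  (hEdges S').filter fun x => hEdge y x ∈ ω

/-- **One row, deterministically**: given the open vertical edges `O` and open horizontal edges
`H` of the new row, the new two-star state is restrict–insert–vertical–horizontal–wire applied to
the old one (the map whose average over `O, H` is the letter `rowLetter`). [folklore] -/
def rowMap (S S' : Finset ℤ) (WA' WB' O H : Finset S') (π : RowState₂ S) : RowState₂ S' :=
  wire WB' 1 (wire WA' 0 (rowStep₂ O H
    (insertState₂ (Finset.inter_subset_right : S ∩ S' ⊆ S')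
      (restrictState₂ (Finset.inter_subset_left : S ∩ S' ⊆ S) π))))

variable (V : Finset (Site 2)) (WA WB : Set (Site 2)) (b : ℤ)

/-- **The row state as a random variable.** The two-star connectivity state of row `b + n`
computed recursively from the bond configuration `ω` by the maps `rowMap` of the rows
`b + 1, …, b + n` (wires `W_A`, `W_B`), started from the free state on row `b`. [folklore] -/
def partRec (ω : BondConfig (Site 2)) : (n : ℕ) → RowState₂ (rowCols V (b + n))
  | 0 => RowState₂.free _
  | n + 1 =>
    rowMap (rowCols V (b + n)) (rowCols V (b + (n + 1 : ℕ)))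
      (rowWires WA _ (b + (n + 1 : ℕ))) (rowWires WB _ (b + (n + 1 : ℕ)))
      (openVert ω _ (b + n) (b + (n + 1 : ℕ))) (openHoriz ω _ (b + (n + 1 : ℕ)))
      (partRec ω n)

/-- The lower endpoint, in `APoint`, of the vertical edge below column `x` of row `y`: the site
`(x, y')` of the previous row `y'` if that is a vertex of `V`, and (a trivial generator) the site
`(x, y)` itself for a phantom column. [folklore] -/
def dpt (y' y : ℤ) (S' : Finset ℤ) (x : S') : APoint :=
  if (x : ℤ) ∈ rowCols V y' then Sum.inl ![(x : ℤ), y'] else Sum.inl ![(x : ℤ), y]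

/-- The classes generated by the open vertical edges between rows `y'` and `y`. [folklore] -/
def vertGen (ω : BondConfig (Site 2)) (S' : Finset ℤ) (y' y : ℤ) : Setoid APoint :=
  (openVert ω S' y' y).sup fun x => pairSetoid (dpt V y' y S' x) (Sum.inl ![(x : ℤ), y])

/-- The classes generated by the open horizontal edges of row `y`. [folklore] -/
def horizGen (ω : BondConfig (Site 2)) (S' : Finset ℤ) (y : ℤ) : Setoid APoint :=
  (openHoriz ω S' y).sup fun x => pairSetoid (Sum.inl ![(x : ℤ), y]) (Sum.inl ![(x : ℤ) + 1, y])

/-- The classes generated by wiring the columns of row `y` lying in `W` to the star `i`.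
[folklore] -/
def wireGen (W : Set (Site 2)) (S' : Finset ℤ) (y : ℤ) (i : Fin 2) : Setoid APoint :=
  (rowWires W S' y).sup fun x => pairSetoid (Sum.inl ![(x : ℤ), y]) (Sum.inr i)

/-- **The augmented connectivity relation** after `n` rows: the classes of `APoint` generated
by the open edges of `V` in the rows `b + 1, …, b + n` (vertical ones towards the previous row,
horizontal ones inside the row) and by the wires of these rows to the two stars. [folklore] -/
def augRel (ω : BondConfig (Site 2)) : ℕ → Setoid APoint
  | 0 => ⊥
  | n + 1 =>
    augRel ω n ⊔ vertGen V ω (rowCols V (b + (n + 1 : ℕ))) (b + n) (b + (n + 1 : ℕ)) ⊔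
      horizGen ω (rowCols V (b + (n + 1 : ℕ))) (b + (n + 1 : ℕ)) ⊔
      wireGen WA (rowCols V (b + (n + 1 : ℕ))) (b + (n + 1 : ℕ)) 0 ⊔
      wireGen WB (rowCols V (b + (n + 1 : ℕ))) (b + (n + 1 : ℕ)) 1

/-- A point of `APoint` lies in the rows `≤ b + n` (stars always do). [folklore] -/
def IsLow (n : ℕ) : APoint → Prop
  | Sum.inl u => u 1 ≤ b + n
  | Sum.inr _ => True

/-- `collapseSetoid` is monotone in the predicate. [folklore] -/
theorem collapseSetoid_mono {α : Type*} {P P' : α → Prop} (h : ∀ x, P x → P' x) :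
    collapseSetoid P ≤ collapseSetoid P' := by
  rintro x y (rfl | ⟨hx, hy⟩)
  · exact Or.inl rfl
  · exact Or.inr ⟨h x hx, h y hy⟩

/-- After `n` rows only points of the rows `≤ b + n` (and the stars) have been joined to
anything. [folklore] -/
theorem augRel_le_collapse (ω : BondConfig (Site 2)) (n : ℕ) :
    augRel V WA WB b ω n ≤ collapseSetoid (IsLow b n) := by
  induction n with
  | zero => exact bot_le
  | succ n ih =>
    have hmono : collapseSetoid (IsLow b n) ≤ collapseSetoid (IsLow b (n + 1)) := by
      refine collapseSetoid_mono ?_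
      rintro (u | i) hu
      · change u 1 ≤ b + (n + 1 : ℕ)
        change u 1 ≤ b + n at hu
        push_cast
        linarith
      · trivial
    have hsite : ∀ (x y : ℤ), y ≤ b + (n + 1 : ℕ) →
        IsLow b (n + 1) (Sum.inl ![x, y] : APoint) := by
      intro x y hy
      change (![x, y] : Site 2) 1 ≤ b + (n + 1 : ℕ)
      simpa using hy
    refine sup_le (sup_le (sup_le (sup_le (ih.trans hmono) ?_) ?_) ?_) ?_
    · refine Finset.sup_le fun x _ => pairSetoid_le_iff.2 (Or.inr ⟨?_, hsite _ _ le_rfl⟩)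
      unfold dpt
      split_ifs
      · exact hsite _ _ (by push_cast; linarith)
      · exact hsite _ _ le_rfl
    · exact Finset.sup_le fun x _ =>
        pairSetoid_le_iff.2 (Or.inr ⟨hsite _ _ le_rfl, hsite _ _ le_rfl⟩)
    · exact Finset.sup_le fun x _ => pairSetoid_le_iff.2 (Or.inr ⟨hsite _ _ le_rfl, trivial⟩)
    · exact Finset.sup_le fun x _ => pairSetoid_le_iff.2 (Or.inr ⟨hsite _ _ le_rfl, trivial⟩)

/-- The sites of row `b + n + 1` are singleton classes after `n` rows. [folklore] -/
theorem augRel_newRow_eq (ω : BondConfig (Site 2)) (n : ℕ) (x : ℤ) (z : APoint)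
    (h : augRel V WA WB b ω n (Sum.inl ![x, b + (n + 1 : ℕ)]) z) :
    z = Sum.inl ![x, b + (n + 1 : ℕ)] := by
  rcases augRel_le_collapse V WA WB b ω n h with h | ⟨h, -⟩
  · exact h.symm
  · change (![x, b + (n + 1 : ℕ)] : Site 2) 1 ≤ b + n at h
    simp only [Matrix.cons_val_one, Matrix.cons_val_fin_one] at h
    push_cast at h
    linarith

/-- `hEdgeRel₂` as a `pairSetoid` (trivial when `x + 1 ∉ S`). [folklore] -/
theorem hEdgeRel₂_eq_pairSetoid {S : Finset ℤ} (x : S) :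
    hEdgeRel₂ x = pairSetoid (Sum.inl x : RowPoint₂ S)
      (Sum.inl (if h : (x : ℤ) + 1 ∈ S then ⟨(x : ℤ) + 1, h⟩ else x)) := by
  unfold hEdgeRel₂
  split_ifs with h
  · rfl
  · exact (pairSetoid_self _).symm

/-- **The row invariant.** The recursively computed two-star state of row `b + n` is the
partition induced on that row (and the stars) by the augmented connectivity relation after `n`
rows. [folklore] -/
theorem partRec_rel (ω : BondConfig (Site 2)) (n : ℕ) :
    (partRec V WA WB b ω n).rel =
      Setoid.comap (emb (rowCols V (b + n)) (b + n)) (augRel V WA WB b ω n) := by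
  induction n with
  | zero =>
    ext p q
    rw [Setoid.comap_rel]
    change p = q ↔ (⊥ : Setoid APoint) (emb _ _ p) (emb _ _ q)
    rw [Setoid.bot_def]
    exact (emb_injective _ _).eq_iff.symm
  | succ n ih =>
    -- names
    have hf := emb_injective (rowCols V (b + (n + 1 : ℕ))) (b + (n + 1 : ℕ))
    -- unfold one step of the recursion
    change wireRel _ 1 (wireRel _ 0 (horizRel₂ _ (vertRel₂ _ (insertRel₂ _
      (restrictRel₂ _ (partRec V WA WB b ω n).rel))))) = _
    rw [ih]
    -- the vertical layer
    have hnew : ∀ (x : rowCols V (b + (n + 1 : ℕ))) (z : APoint),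
        augRel V WA WB b ω n (emb (rowCols V (b + (n + 1 : ℕ))) (b + (n + 1 : ℕ)) (Sum.inl x)) z →
          z = emb (rowCols V (b + (n + 1 : ℕ))) (b + (n + 1 : ℕ)) (Sum.inl x) :=
      fun x z hz => augRel_newRow_eq V WA WB b ω n x z hz
    have hfg : ∀ (x : rowCols V (b + (n + 1 : ℕ))) (p : RowPoint₂ (rowCols V (b + n))),
        emb (rowCols V (b + (n + 1 : ℕ))) (b + (n + 1 : ℕ)) (Sum.inl x) ≠
          emb (rowCols V (b + n)) (b + n) p := by
      rintro x (x' | i) h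
      · simp only [emb, Sum.inl.injEq] at h
        have h1 := congrFun h 1
        simp only [Matrix.cons_val_one, Matrix.cons_val_fin_one] at h1
        push_cast at h1
        linarith
      · simp [emb] at h
    have hdS : ∀ (x : rowCols V (b + (n + 1 : ℕ))) (hx : (x : ℤ) ∈ rowCols V (b + n)),
        dpt V (b + n) (b + (n + 1 : ℕ)) (rowCols V (b + (n + 1 : ℕ))) x =
          emb (rowCols V (b + n)) (b + n) (Sum.inl ⟨x, hx⟩) := by
      intro x hx
      simp only [dpt, if_pos hx]
      rfl
    have hdnS : ∀ (x : rowCols V (b + (n + 1 : ℕ))), (x : ℤ) ∉ rowCols V (b + n) →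
        dpt V (b + n) (b + (n + 1 : ℕ)) (rowCols V (b + (n + 1 : ℕ))) x =
          emb (rowCols V (b + (n + 1 : ℕ))) (b + (n + 1 : ℕ)) (Sum.inl x) := by
      intro x hx
      simp only [dpt, if_neg hx]
      rfl
    have hV := comap_sup_vert_eq_vertRel₂ (emb (rowCols V (b + (n + 1 : ℕ))) (b + (n + 1 : ℕ)))
        (emb (rowCols V (b + n)) (b + n)) (augRel V WA WB b ω n)
        (openVert ω (rowCols V (b + (n + 1 : ℕ))) (b + n) (b + (n + 1 : ℕ)))
        (dpt V (b + n) (b + (n + 1 : ℕ)) (rowCols V (b + (n + 1 : ℕ)))) hf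
        (fun i => rfl) hnew hfg hdS hdnS
    rw [← hV]
    -- the horizontal layer
    have hH : ∀ R : Setoid APoint,
        horizRel₂ (openHoriz ω (rowCols V (b + (n + 1 : ℕ))) (b + (n + 1 : ℕ)))
          (Setoid.comap (emb (rowCols V (b + (n + 1 : ℕ))) (b + (n + 1 : ℕ))) R) =
        Setoid.comap (emb (rowCols V (b + (n + 1 : ℕ))) (b + (n + 1 : ℕ)))
          (R ⊔ horizGen ω (rowCols V (b + (n + 1 : ℕ))) (b + (n + 1 : ℕ))) := by
      intro R
      unfold horizRel₂ horizGen
      rw [show (openHoriz ω (rowCols V (b + (n + 1 : ℕ))) (b + (n + 1 : ℕ))).sup hEdgeRel₂ =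
          (openHoriz ω (rowCols V (b + (n + 1 : ℕ))) (b + (n + 1 : ℕ))).sup fun x =>
            pairSetoid (Sum.inl x : RowPoint₂ (rowCols V (b + (n + 1 : ℕ))))
              (Sum.inl (if h : (x : ℤ) + 1 ∈ rowCols V (b + (n + 1 : ℕ)) then
                ⟨(x : ℤ) + 1, h⟩ else x)) from
          Finset.sup_congr rfl fun x _ => hEdgeRel₂_eq_pairSetoid x]
      rw [← comap_sup_pairs (emb (rowCols V (b + (n + 1 : ℕ))) (b + (n + 1 : ℕ))) R
        (openHoriz ω (rowCols V (b + (n + 1 : ℕ))) (b + (n + 1 : ℕ)))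
        (fun x => (Sum.inl x : RowPoint₂ (rowCols V (b + (n + 1 : ℕ)))))
        (fun x => Sum.inl (if h : (x : ℤ) + 1 ∈ rowCols V (b + (n + 1 : ℕ)) then
          ⟨(x : ℤ) + 1, h⟩ else x))]
      congr 2
      refine Finset.sup_congr rfl fun x hx => ?_
      have hx' : (x : ℤ) + 1 ∈ rowCols V (b + (n + 1 : ℕ)) := by
        unfold openHoriz hEdges at hx
        simp only [Finset.mem_filter, Finset.mem_univ, true_and] at hx
        exact hx.1
      simp only [dif_pos hx']
      rfl
    rw [hH]
    -- the wires
    have hW : ∀ (R : Setoid APoint) (W : Set (Site 2)) (i : Fin 2),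
        wireRel (rowWires W (rowCols V (b + (n + 1 : ℕ))) (b + (n + 1 : ℕ))) i
          (Setoid.comap (emb (rowCols V (b + (n + 1 : ℕ))) (b + (n + 1 : ℕ))) R) =
        Setoid.comap (emb (rowCols V (b + (n + 1 : ℕ))) (b + (n + 1 : ℕ)))
          (R ⊔ wireGen W (rowCols V (b + (n + 1 : ℕ))) (b + (n + 1 : ℕ)) i) := by
      intro R W i
      unfold wireRel wireGen
      exact (comap_sup_pairs (emb (rowCols V (b + (n + 1 : ℕ))) (b + (n + 1 : ℕ))) R
        (rowWires W (rowCols V (b + (n + 1 : ℕ))) (b + (n + 1 : ℕ)))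
        (fun x => (Sum.inl x : RowPoint₂ (rowCols V (b + (n + 1 : ℕ)))))
        (fun _ => Sum.inr i)).symm
    rw [hW, hW]
    rfl

end RowData

/-! ### The augmented graph and the crossing event -/

section AugGraph

variable (V : Finset (Site 2)) (WA WB : Set (Site 2)) (b : ℤ)

/-- The generating relation of the augmented graph of `ω`: open `ℤ²`-edges with both endpoints in
`V`, and the wires from the vertices of `V ∩ W_A` to `⋆_A`, of `V ∩ W_B` to `⋆_B`. [folklore] -/
def augAdjRel (ω : BondConfig (Site 2)) : APoint → APoint → Prop
  | Sum.inl u, Sum.inl v => u ∈ V ∧ v ∈ V ∧ (zdGraph 2).Adj u v ∧ s(u, v) ∈ ω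
  | Sum.inl u, Sum.inr i => u ∈ V ∧ u ∈ (![WA, WB] : Fin 2 → Set (Site 2)) i
  | Sum.inr _, _ => False

/-- **The augmented graph** of `ω` on `APoint`: the open subgraph of `ℤ²` induced on `V`, plus an
edge from every vertex of `V ∩ W_A` to `⋆_A` and from every vertex of `V ∩ W_B` to `⋆_B`.
[folklore] -/
def augGraph (ω : BondConfig (Site 2)) : SimpleGraph APoint :=
  SimpleGraph.fromRel (augAdjRel V WA WB ω)

/-- **The open subgraph of `ℤ²` induced on `V`** (as a graph on all sites, the sites outside `V`
isolated). [folklore] -/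
def siteGraph (ω : BondConfig (Site 2)) : SimpleGraph (Site 2) :=
  SimpleGraph.fromRel fun u v => u ∈ V ∧ v ∈ V ∧ (zdGraph 2).Adj u v ∧ s(u, v) ∈ ω

/-- Adjacency in `siteGraph`. [folklore] -/
theorem siteGraph_adj {ω : BondConfig (Site 2)} {u v : Site 2} :
    (siteGraph V ω).Adj u v ↔ u ∈ V ∧ v ∈ V ∧ (zdGraph 2).Adj u v ∧ s(u, v) ∈ ω := by
  rw [siteGraph, SimpleGraph.fromRel_adj]
  constructor
  · rintro ⟨-, h | ⟨hv, hu, hadj, he⟩⟩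
    · exact h
    · exact ⟨hu, hv, hadj.symm, by rwa [Sym2.eq_swap]⟩
  · intro h
    exact ⟨h.2.2.1.ne, Or.inl h⟩

/-- `augRel` is monotone in the number of rows. [folklore] -/
theorem augRel_mono (ω : BondConfig (Site 2)) {m n : ℕ} (h : m ≤ n) :
    augRel V WA WB b ω m ≤ augRel V WA WB b ω n := by
  induction h with
  | refl => exact le_rfl
  | step _ ih =>
    exact ih.trans (le_sup_left.trans (le_sup_left.trans (le_sup_left.trans le_sup_left)))

/-- Every generator of `augRel` is an edge (or a loop) of the augmented graph. [folklore] -/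
theorem augRel_le_reachable (ω : BondConfig (Site 2)) (n : ℕ) :
    augRel V WA WB b ω n ≤ (augGraph V WA WB ω).reachableSetoid := by
  have vec_add_single_one : ∀ x y : ℤ, (![x, y] : Site 2) + Pi.single 1 1 = ![x, y + 1] :=
    fun x y => by ext i; fin_cases i <;> simp
  have vec_add_single_zero : ∀ x y : ℤ, (![x, y] : Site 2) + Pi.single 0 1 = ![x + 1, y] :=
    fun x y => by ext i; fin_cases i <;> simp
  have hadj : ∀ p q : APoint, augAdjRel V WA WB ω p q → (augGraph V WA WB ω).Reachable p q := by
    intro p q h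
    by_cases hpq : p = q
    · rw [hpq]
    · refine SimpleGraph.Adj.reachable ?_
      rw [augGraph, SimpleGraph.fromRel_adj]
      exact ⟨hpq, Or.inl h⟩
  induction n with
  | zero => exact bot_le
  | succ n ih =>
    refine sup_le (sup_le (sup_le (sup_le ih ?_) ?_) ?_) ?_
    · refine Finset.sup_le fun x hx => pairSetoid_le_iff.2 ?_
      unfold openVert at hx
      rw [Finset.mem_filter] at hx
      unfold dpt
      split_ifs with hmem
      · refine hadj _ _ ⟨mem_rowCols.1 hmem, mem_rowCols.1 x.2, ?_, hx.2⟩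
        rw [zdGraph_adj_iff]
        refine ⟨1, Or.inl ?_⟩
        rw [vec_add_single_one]
        push_cast
        ring_nf
      · exact Setoid.refl' _ _
    · refine Finset.sup_le fun x hx => pairSetoid_le_iff.2 ?_
      unfold openHoriz hEdges at hx
      simp only [Finset.mem_filter, Finset.mem_univ, true_and] at hx
      refine hadj _ _ ⟨mem_rowCols.1 x.2, mem_rowCols.1 hx.1, ?_, hx.2⟩
      rw [zdGraph_adj_iff]
      exact ⟨0, Or.inl (vec_add_single_zero _ _).symm⟩
    · refine Finset.sup_le fun x hx => pairSetoid_le_iff.2 ?_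
      rw [mem_rowWires] at hx
      exact hadj _ _ ⟨mem_rowCols.1 x.2, by simpa using hx⟩
    · refine Finset.sup_le fun x hx => pairSetoid_le_iff.2 ?_
      rw [mem_rowWires] at hx
      exact hadj _ _ ⟨mem_rowCols.1 x.2, by simpa using hx⟩

variable {V b}

/-- The row generators are relations of the later `augRel`. [folklore] -/
theorem gens_le_augRel (ω : BondConfig (Site 2)) {n N : ℕ} (hnN : n + 1 ≤ N) :
    vertGen V ω (rowCols V (b + (n + 1 : ℕ))) (b + n) (b + (n + 1 : ℕ)) ≤ augRel V WA WB b ω N ∧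
    horizGen ω (rowCols V (b + (n + 1 : ℕ))) (b + (n + 1 : ℕ)) ≤ augRel V WA WB b ω N ∧
    wireGen WA (rowCols V (b + (n + 1 : ℕ))) (b + (n + 1 : ℕ)) 0 ≤ augRel V WA WB b ω N ∧
    wireGen WB (rowCols V (b + (n + 1 : ℕ))) (b + (n + 1 : ℕ)) 1 ≤ augRel V WA WB b ω N := by
  have hstep := augRel_mono V WA WB b ω hnN
  have e : augRel V WA WB b ω (n + 1) =
      augRel V WA WB b ω n ⊔ vertGen V ω (rowCols V (b + (n + 1 : ℕ))) (b + n) (b + (n + 1 : ℕ)) ⊔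
        horizGen ω (rowCols V (b + (n + 1 : ℕ))) (b + (n + 1 : ℕ)) ⊔
        wireGen WA (rowCols V (b + (n + 1 : ℕ))) (b + (n + 1 : ℕ)) 0 ⊔
        wireGen WB (rowCols V (b + (n + 1 : ℕ))) (b + (n + 1 : ℕ)) 1 := rfl
  rw [e] at hstep
  exact ⟨(le_sup_right.trans (le_sup_left.trans (le_sup_left.trans le_sup_left))).trans hstep,
    (le_sup_right.trans (le_sup_left.trans le_sup_left)).trans hstep,
    (le_sup_right.trans le_sup_left).trans hstep, le_sup_right.trans hstep⟩

/-- An open horizontal edge of `V` in a row of `(b, b + N]` is a relation of `augRel … N`.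
[folklore] -/
theorem augRel_hEdge {N : ℕ} (ω : BondConfig (Site 2)) (x y : ℤ) (hby : b < y) (hyN : y ≤ b + N)
    (hu : (![x, y] : Site 2) ∈ V) (hv : (![x + 1, y] : Site 2) ∈ V)
    (he : s((![x, y] : Site 2), ![x + 1, y]) ∈ ω) :
    augRel V WA WB b ω N (Sum.inl ![x, y]) (Sum.inl ![x + 1, y]) := by
  obtain ⟨n, hn⟩ : ∃ n : ℕ, b + (n + 1 : ℕ) = y := ⟨(y - b - 1).toNat, by omega⟩
  have hnN : n + 1 ≤ N := by omega
  subst hn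
  have huS : x ∈ rowCols V (b + (n + 1 : ℕ)) := mem_rowCols.2 hu
  have hx : (⟨x, huS⟩ : rowCols V (b + (n + 1 : ℕ))) ∈
      openHoriz ω (rowCols V (b + (n + 1 : ℕ))) (b + (n + 1 : ℕ)) := by
    unfold openHoriz hEdges
    simp only [Finset.mem_filter, Finset.mem_univ, true_and]
    exact ⟨mem_rowCols.2 hv, he⟩
  exact (gens_le_augRel WA WB ω hnN).2.1
    ((Finset.le_sup (f := fun x : rowCols V (b + (n + 1 : ℕ)) =>
      pairSetoid (Sum.inl ![(x : ℤ), b + (n + 1 : ℕ)] : APoint)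
        (Sum.inl ![(x : ℤ) + 1, b + (n + 1 : ℕ)])) hx) (pairSetoid_rel _ _))

/-- An open vertical edge of `V` from a row `> b` to a row `≤ b + N` is a relation of
`augRel … N`. [folklore] -/
theorem augRel_vEdge {N : ℕ} (ω : BondConfig (Site 2)) (x y : ℤ) (hby : b < y)
    (hyN : y + 1 ≤ b + N) (hu : (![x, y] : Site 2) ∈ V) (hv : (![x, y + 1] : Site 2) ∈ V)
    (he : s((![x, y] : Site 2), ![x, y + 1]) ∈ ω) :
    augRel V WA WB b ω N (Sum.inl ![x, y]) (Sum.inl ![x, y + 1]) := by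
  obtain ⟨n, hn⟩ : ∃ n : ℕ, b + (n : ℤ) = y := ⟨(y - b).toNat, by omega⟩
  have hnN : n + 1 ≤ N := by omega
  subst hn
  have ey : b + (n : ℤ) + 1 = b + (n + 1 : ℕ) := by push_cast; ring
  rw [ey] at hv he ⊢
  have hvS : x ∈ rowCols V (b + (n + 1 : ℕ)) := mem_rowCols.2 hv
  have huS : x ∈ rowCols V (b + n) := mem_rowCols.2 hu
  have hx : (⟨x, hvS⟩ : rowCols V (b + (n + 1 : ℕ))) ∈
      openVert ω (rowCols V (b + (n + 1 : ℕ))) (b + n) (b + (n + 1 : ℕ)) := by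
    unfold openVert
    simp only [Finset.mem_filter, Finset.mem_univ, true_and]
    exact he
  have := (Finset.le_sup (f := fun x : rowCols V (b + (n + 1 : ℕ)) =>
    pairSetoid (dpt V (b + n) (b + (n + 1 : ℕ)) (rowCols V (b + (n + 1 : ℕ))) x)
      (Sum.inl ![(x : ℤ), b + (n + 1 : ℕ)] : APoint)) hx) (pairSetoid_rel _ _)
  simp only [dpt, huS, if_true] at this
  exact (gens_le_augRel WA WB ω hnN).1 this

/-- A wire from a vertex of `V` in a row of `(b, b + N]` is a relation of `augRel … N`.
[folklore] -/
theorem augRel_wire {N : ℕ} (ω : BondConfig (Site 2)) (x y : ℤ) (i : Fin 2) (hby : b < y)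
    (hyN : y ≤ b + N) (hu : (![x, y] : Site 2) ∈ V)
    (hW : (![x, y] : Site 2) ∈ (![WA, WB] : Fin 2 → Set (Site 2)) i) :
    augRel V WA WB b ω N (Sum.inl ![x, y]) (Sum.inr i) := by
  obtain ⟨n, hn⟩ : ∃ n : ℕ, b + (n + 1 : ℕ) = y := ⟨(y - b - 1).toNat, by omega⟩
  have hnN : n + 1 ≤ N := by omega
  subst hn
  have huS : x ∈ rowCols V (b + (n + 1 : ℕ)) := mem_rowCols.2 hu
  fin_cases i
  · have hx : (⟨x, huS⟩ : rowCols V (b + (n + 1 : ℕ))) ∈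
        rowWires WA (rowCols V (b + (n + 1 : ℕ))) (b + (n + 1 : ℕ)) := by
      rw [mem_rowWires]
      simpa using hW
    exact (gens_le_augRel WA WB ω hnN).2.2.1
      ((Finset.le_sup (f := fun x : rowCols V (b + (n + 1 : ℕ)) =>
        pairSetoid (Sum.inl ![(x : ℤ), b + (n + 1 : ℕ)] : APoint) (Sum.inr 0)) hx)
        (pairSetoid_rel _ _))
  · have hx : (⟨x, huS⟩ : rowCols V (b + (n + 1 : ℕ))) ∈
        rowWires WB (rowCols V (b + (n + 1 : ℕ))) (b + (n + 1 : ℕ)) := by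
      rw [mem_rowWires]
      simpa using hW
    exact (gens_le_augRel WA WB ω hnN).2.2.2
      ((Finset.le_sup (f := fun x : rowCols V (b + (n + 1 : ℕ)) =>
        pairSetoid (Sum.inl ![(x : ℤ), b + (n + 1 : ℕ)] : APoint) (Sum.inr 1)) hx)
        (pairSetoid_rel _ _))

/-- If every vertex of `V` lies in the rows `(b, b + N]`, every edge of the augmented graph is a
relation of `augRel … N`. [folklore] -/
theorem augAdjRel_le_augRel {N : ℕ} (hrows : ∀ v ∈ V, b < v 1 ∧ v 1 ≤ b + N)
    (ω : BondConfig (Site 2)) {p q : APoint} (h : augAdjRel V WA WB ω p q) :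
    augRel V WA WB b ω N p q := by
  have site_eq : ∀ u : Site 2, u = ![u 0, u 1] := fun u => by ext i; fin_cases i <;> rfl
  have vec_add_single_one : ∀ x y : ℤ, (![x, y] : Site 2) + Pi.single 1 1 = ![x, y + 1] :=
    fun x y => by ext i; fin_cases i <;> simp
  have vec_add_single_zero : ∀ x y : ℤ, (![x, y] : Site 2) + Pi.single 0 1 = ![x + 1, y] :=
    fun x y => by ext i; fin_cases i <;> simp
  rcases p with u | i <;> rcases q with v | j
  · obtain ⟨hu, hv, hadj, he⟩ := h
    -- an open edge `{u, u + eᵢ}` of `V`, in coordinates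
    have key : ∀ (u : Site 2) (i : Fin 2), u ∈ V → u + Pi.single i 1 ∈ V →
        s(u, u + Pi.single i 1) ∈ ω →
        augRel V WA WB b ω N (Sum.inl u) (Sum.inl (u + Pi.single i 1)) := by
      intro u i hu hv he
      obtain ⟨x, y, rfl⟩ : ∃ x y : ℤ, u = ![x, y] := ⟨u 0, u 1, site_eq u⟩
      obtain ⟨hb, hbN⟩ := hrows _ hu
      obtain ⟨hb', hbN'⟩ := hrows _ hv
      fin_cases i
      · simp only [Fin.zero_eta, vec_add_single_zero] at hv he ⊢
        exact augRel_hEdge WA WB ω x y (by simpa using hb) (by simpa using hbN) hu hv he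
      · simp only [Fin.mk_one, vec_add_single_one] at hv he hbN' ⊢
        exact augRel_vEdge WA WB ω x y (by simpa using hb) (by simpa using hbN') hu hv he
    obtain ⟨i, hi | hi⟩ := (zdGraph_adj_iff u v).1 hadj
    · subst hi
      exact key u i hu hv he
    · subst hi
      rw [Sym2.eq_swap] at he
      exact Setoid.symm' _ (key v i hv hu he)
  · obtain ⟨hu, hW⟩ := h
    obtain ⟨x, y, rfl⟩ : ∃ x y : ℤ, u = ![x, y] := ⟨u 0, u 1, site_eq u⟩
    obtain ⟨hb, hbN⟩ := hrows _ hu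
    exact augRel_wire WA WB ω x y j (by simpa using hb) (by simpa using hbN) hu hW
  · exact h.elim
  · exact h.elim

/-- **After all rows, the augmented relation is connectivity in the augmented graph.**
[folklore] -/
theorem augRel_iff_reachable {N : ℕ} (hrows : ∀ v ∈ V, b < v 1 ∧ v 1 ≤ b + N)
    (ω : BondConfig (Site 2)) (p q : APoint) :
    augRel V WA WB b ω N p q ↔ (augGraph V WA WB ω).Reachable p q := by
  constructor
  · exact fun h => augRel_le_reachable V WA WB b ω N h
  · rintro ⟨w⟩
    induction w with
    | nil => exact Setoid.refl' _ _
    | @cons x y z hadj w ih =>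
      refine Setoid.trans' _ ?_ ih
      rw [augGraph, SimpleGraph.fromRel_adj] at hadj
      rcases hadj with ⟨-, h | h⟩
      · exact augAdjRel_le_augRel WA WB hrows ω h
      · exact Setoid.symm' _ (augAdjRel_le_augRel WA WB hrows ω h)

variable (V)

/-- A walk of the augmented graph from a site to `⋆_B` avoiding `⋆_A` yields an open path in
`V` from the site to a vertex of `W_B`. [folklore] -/
theorem exists_of_walk_to_starB (ω : BondConfig (Site 2)) :
    ∀ {p q : APoint} (w : (augGraph V WA WB ω).Walk p q) (u : Site 2), p = Sum.inl u →
      q = Sum.inr 1 → (Sum.inr 0 : APoint) ∉ w.support → u ∈ V →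
      ∃ y ∈ WB, y ∈ V ∧ (siteGraph V ω).Reachable u y := by
  intro p q w
  induction w with
  | nil =>
    rintro u rfl h - -
    exact absurd h Sum.inl_ne_inr
  | @cons p r q hadj w ih =>
    rintro u rfl hq hsupp hu
    rw [SimpleGraph.Walk.support_cons, List.mem_cons, not_or] at hsupp
    rw [augGraph, SimpleGraph.fromRel_adj] at hadj
    obtain ⟨hne, h⟩ := hadj
    rcases r with u' | j
    · -- a step inside `V`
      have hadj' : (siteGraph V ω).Adj u u' := by
        rw [siteGraph_adj]
        rcases h with h | ⟨hv, hu, hadj, he⟩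
        · exact h
        · exact ⟨hu, hv, hadj.symm, by rwa [Sym2.eq_swap]⟩
      obtain ⟨y, hyB, hyV, hreach⟩ := ih u' rfl hq hsupp.2 ((siteGraph_adj V).1 hadj').2.1
      exact ⟨y, hyB, hyV, hadj'.reachable.trans hreach⟩
    · -- a wire: it must go to `⋆_B`, so `u ∈ W_B`
      rcases h with ⟨-, hW⟩ | h
      · have hj : j ≠ 0 := by
          rintro rfl
          exact hsupp.2 w.start_mem_support
        obtain rfl : j = 1 := Fin.eq_one_of_ne_zero j hj
        exact ⟨u, by simpa using hW, hu, SimpleGraph.Reachable.refl _⟩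
      · exact h.elim

/-- **The two stars are joined in the augmented graph iff some vertex of `V ∩ W_A` is joined to
some vertex of `V ∩ W_B` by an open path inside `V`.** [folklore] -/
theorem reachable_stars_iff (ω : BondConfig (Site 2)) :
    (augGraph V WA WB ω).Reachable (Sum.inr 0) (Sum.inr 1) ↔
      ∃ x ∈ WA, x ∈ V ∧ ∃ y ∈ WB, y ∈ V ∧ (siteGraph V ω).Reachable x y := by
  constructor
  · rintro ⟨w⟩
    obtain ⟨p, hp⟩ := w.toPath
    cases p with
    | @cons _ r _ hadj p' =>
      rw [SimpleGraph.Walk.cons_isPath_iff] at hp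
      rw [augGraph, SimpleGraph.fromRel_adj] at hadj
      obtain ⟨hne, h⟩ := hadj
      rcases r with u | j
      · rcases h with h | ⟨hu, hW⟩
        · exact h.elim
        · obtain ⟨y, hyB, hyV, hreach⟩ :=
            exists_of_walk_to_starB V WA WB ω p' u rfl rfl hp.2 hu
          exact ⟨u, by simpa using hW, hu, y, hyB, hyV, hreach⟩
      · rcases h with h | h <;> exact h.elim
  · rintro ⟨x, hxA, hxV, y, hyB, hyV, hreach⟩
    have h1 : (augGraph V WA WB ω).Adj (Sum.inr 0) (Sum.inl x) := by
      rw [augGraph, SimpleGraph.fromRel_adj]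
      exact ⟨Sum.inr_ne_inl, Or.inr ⟨hxV, by simpa using hxA⟩⟩
    have h3 : (augGraph V WA WB ω).Adj (Sum.inl y) (Sum.inr 1) := by
      rw [augGraph, SimpleGraph.fromRel_adj]
      exact ⟨Sum.inl_ne_inr, Or.inl ⟨hyV, by simpa using hyB⟩⟩
    -- the inclusion of sites is a graph homomorphism
    let φ : siteGraph V ω →g augGraph V WA WB ω :=
      { toFun := Sum.inl
        map_rel' := by
          intro u v hadj
          rw [augGraph, SimpleGraph.fromRel_adj]
          rw [siteGraph_adj] at hadj
          exact ⟨fun h => hadj.2.2.1.ne (Sum.inl_injective h), Or.inl hadj⟩ }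
    have h2 : (augGraph V WA WB ω).Reachable (Sum.inl x) (Sum.inl y) := hreach.map φ
    exact h1.reachable.trans (h2.trans h3.reachable)

end AugGraph

/-! ### The letter as an average of deterministic row maps -/

section Letter

variable {ι κ ρ : Type*} [Fintype ι] [Fintype κ] [Fintype ρ]

omit [Fintype κ] in
/-- Pointwise formula for the push-forward. [folklore] -/
theorem statePushforward_apply (f : ι → κ) (μ : ι → ℝ) (k : κ) :
    statePushforward f μ k = ∑ i, if f i = k then μ i else 0 := by
  simp only [statePushforward, LinearMap.coe_mk, AddHom.coe_mk]
  rw [Finset.sum_filter]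

omit [Fintype ρ] in
/-- Push-forwards compose. [folklore] -/
theorem statePushforward_comp (g : κ → ρ) (f : ι → κ) (μ : ι → ℝ) :
    statePushforward g (statePushforward f μ) = statePushforward (g ∘ f) μ := by
  funext r
  simp only [statePushforward_apply, Function.comp_apply]
  have key : ∀ k, (if g k = r then ∑ i, (if f i = k then μ i else 0) else 0) =
      ∑ i, if f i = k then (if g (f i) = r then μ i else 0) else 0 := by
    intro k
    split_ifs with hk
    · refine Finset.sum_congr rfl fun i _ => ?_
      by_cases hi : f i = k
      · rw [if_pos hi, if_pos hi, if_pos (by rw [hi]; exact hk)]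
      · rw [if_neg hi, if_neg hi]
    · symm
      refine Finset.sum_eq_zero fun i _ => ?_
      by_cases hi : f i = k
      · rw [if_pos hi, if_neg (by rw [hi]; exact hk)]
      · rw [if_neg hi]
  simp_rw [key]
  rw [Finset.sum_comm]
  refine Finset.sum_congr rfl fun i _ => ?_
  rw [Finset.sum_ite_eq]
  exact if_pos (Finset.mem_univ _)

/-- The transfer step as the average, over the vertical and horizontal edge configurations, of
the push-forwards along the deterministic row steps. [folklore] -/
theorem transferLin₂_eq (S : Finset ℤ) (ν : RowState₂ S → ℝ) :
    transferLin₂ S ν = (1 / ((2 : ℝ) ^ S.card * 2 ^ (hEdges S).card)) •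
      ∑ OH ∈ (univ : Finset (Finset S)) ×ˢ (hEdges S).powerset,
        statePushforward (rowStep₂ OH.1 OH.2) ν := by
  funext π'
  simp only [transferLin₂, Matrix.vecMulLinear_apply, Matrix.vecMul, dotProduct,
    PercolationRowTransfer₂, Pi.smul_apply, Finset.sum_apply, statePushforward_apply, smul_eq_mul]
  calc ∑ π, ν π * ((((univ : Finset (Finset S)) ×ˢ (hEdges S).powerset).filter
          (fun OH => rowStep₂ OH.1 OH.2 π = π')).card / ((2 : ℝ) ^ S.card * 2 ^ (hEdges S).card))
      = ∑ π, (1 / ((2 : ℝ) ^ S.card * 2 ^ (hEdges S).card)) *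
          ∑ OH ∈ (univ : Finset (Finset S)) ×ˢ (hEdges S).powerset,
            (if rowStep₂ OH.1 OH.2 π = π' then ν π else 0) := by
        refine Finset.sum_congr rfl fun π _ => ?_
        rw [Finset.card_filter, Nat.cast_sum, Finset.mul_sum, Finset.sum_div, Finset.mul_sum]
        refine Finset.sum_congr rfl fun OH _ => ?_
        push_cast
        split_ifs <;> ring
    _ = _ := by rw [← Finset.mul_sum, Finset.sum_comm]

/-- **The letter is the average of the deterministic row maps**:
`rowLetter = (1/Z) Σ_{O, H} push (rowMap O H)`. [folklore] -/
theorem rowLetter_eq (S S' : Finset ℤ) (WA' WB' : Finset S') (μ : RowState₂ S → ℝ) :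
    rowLetter S S' WA' WB' μ = (1 / ((2 : ℝ) ^ S'.card * 2 ^ (hEdges S').card)) •
      ∑ OH ∈ (univ : Finset (Finset S')) ×ˢ (hEdges S').powerset,
        statePushforward (rowMap S S' WA' WB' OH.1 OH.2) μ := by
  change statePushforward (wire WB' 1) (statePushforward (wire WA' 0) (transferLin₂ S'
    (statePushforward (insertState₂ _) (statePushforward (restrictState₂ _) μ)))) = _
  rw [transferLin₂_eq, LinearMap.map_smul, LinearMap.map_smul, map_sum, map_sum]
  congr 1
  refine Finset.sum_congr rfl fun OH _ => ?_
  rw [statePushforward_comp, statePushforward_comp, statePushforward_comp,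
    statePushforward_comp]
  rfl

/-- Pointwise form of `rowLetter_eq`. [folklore] -/
theorem rowLetter_apply (S S' : Finset ℤ) (WA' WB' : Finset S') (μ : RowState₂ S → ℝ)
    (π' : RowState₂ S') :
    rowLetter S S' WA' WB' μ π' = (1 / ((2 : ℝ) ^ S'.card * 2 ^ (hEdges S').card)) *
      ∑ OH ∈ (univ : Finset (Finset S')) ×ˢ (hEdges S').powerset,
        ∑ π, if rowMap S S' WA' WB' OH.1 OH.2 π = π' then μ π else 0 := by
  rw [rowLetter_eq]
  simp only [Pi.smul_apply, Finset.sum_apply, statePushforward_apply, smul_eq_mul]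

end Letter

/-! ### Cylinder events of bond percolation at `p = 1/2` -/

section Probability

open _root_.MeasureTheory _root_.ProbabilityTheory
open scoped ENNReal

/-- The cylinder event "the open edges among `E` are exactly those of `A`". [folklore] -/
def boxEvent (E A : Finset (Sym2 (Site 2))) : Set (BondConfig (Site 2)) :=
  {ω | ∀ e ∈ E, e ∈ ω ↔ e ∈ A}

/-- Membership in a cylinder event. [folklore] -/
theorem mem_boxEvent {E A : Finset (Sym2 (Site 2))} {ω : BondConfig (Site 2)} :
    ω ∈ boxEvent E A ↔ ∀ e ∈ E, e ∈ ω ↔ e ∈ A :=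
  Iff.rfl

/-- The one-edge event `{ω | e ∈ ω ↔ c}` is measurable. [folklore] -/
theorem measurableSet_mem_iff (e : Sym2 (Site 2)) (c : Prop) :
    MeasurableSet {ω : BondConfig (Site 2) | e ∈ ω ↔ c} :=
  (measurable_set_mem e) (MeasurableSpace.measurableSet_top : MeasurableSet {P : Prop | P ↔ c})

/-- Cylinder events are measurable. [folklore] -/
theorem measurableSet_boxEvent (E A : Finset (Sym2 (Site 2))) : MeasurableSet (boxEvent E A) := by
  have : boxEvent E A = ⋂ e ∈ E, {ω : BondConfig (Site 2) | e ∈ ω ↔ e ∈ A} := by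
    ext ω
    simp only [boxEvent, Set.mem_setOf_eq, Set.mem_iInter]
  rw [this]
  exact Finset.measurableSet_biInter E fun e _ => measurableSet_mem_iff e _

/-- **The cylinder marginal of `P_{1/2}`**: for a finite set `E` of edges of `ℤ²` and `A`, the
probability that the open edges among `E` are exactly those of `A` is `2^{-|E|}`. [folklore] -/
theorem prob_boxEvent (E A : Finset (Sym2 (Site 2))) (hE : ∀ e ∈ E, e ∈ (zdGraph 2).edgeSet) :
    (bondPercolation (zdGraph 2) half).real (boxEvent E A) = (1 / 2 : ℝ) ^ E.card := by
  rw [bondPercolation, measureReal_def, setBernoulli_apply']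
  have hpre : (fun p : Sym2 (Site 2) → Prop => {i | p i}) ⁻¹' boxEvent E A =
      Set.pi (↑E) (fun e => {P : Prop | P ↔ e ∈ A}) := by
    ext q
    simp only [boxEvent, Set.mem_preimage, Set.mem_setOf_eq, Set.mem_pi, Finset.mem_coe]
  rw [hpre, Measure.infinitePi_pi _ (fun e _ => MeasurableSpace.measurableSet_top)]
  have hfac : ∀ e ∈ E, (unitInterval.toNNReal half • Measure.dirac (e ∈ (zdGraph 2).edgeSet) +
      unitInterval.toNNReal (unitInterval.symm half) • Measure.dirac False : Measure Prop)
        {P : Prop | P ↔ e ∈ A} = ((unitInterval.toNNReal half : NNReal) : ℝ≥0∞) := by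
    intro e he
    rw [show unitInterval.symm half = half from
      Subtype.ext (by rw [unitInterval.coe_symm_eq, coe_half]; norm_num)]
    simp only [Measure.coe_add, Measure.coe_smul, Pi.add_apply, Pi.smul_apply,
      Measure.dirac_apply' _ (MeasurableSpace.measurableSet_top : MeasurableSet {P : Prop | P ↔ e ∈ A}),
      Set.indicator_apply, Set.mem_setOf_eq, Pi.one_apply]
    have htrue : ((e ∈ (zdGraph 2).edgeSet) ↔ e ∈ A) ↔ e ∈ A := iff_true_left (hE e he)
    by_cases hA : e ∈ A
    · rw [if_pos (htrue.2 hA), if_neg (by simp [hA])]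
      simp
    · rw [if_neg (fun h => hA (htrue.1 h)), if_pos (by simp [hA])]
      simp
  rw [Finset.prod_congr rfl hfac, Finset.prod_const, ENNReal.toReal_pow]
  congr 1

/-! ### The edges of one row and of the past rows -/

/-- `vEdge y' y` is injective in the column. [folklore] -/
theorem vEdge_injective (y' y : ℤ) : Function.Injective (vEdge y' y) := by
  intro x x' h
  rw [vEdge, vEdge, Sym2.eq_iff] at h
  rcases h with ⟨h, -⟩ | ⟨h, -⟩
  · have := congrFun h 0; simpa using this
  · have := congrFun h 0; simpa using this

/-- `hEdge y` is injective in the column. [folklore] -/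
theorem hEdge_injective (y : ℤ) : Function.Injective (hEdge y) := by
  intro x x' h
  rw [hEdge, hEdge, Sym2.eq_iff] at h
  rcases h with ⟨h, -⟩ | ⟨h1, h2⟩
  · have := congrFun h 0; simpa using this
  · have e1 := congrFun h1 0
    have e2 := congrFun h2 0
    simp only [Matrix.cons_val_zero] at e1 e2
    omega

/-- A vertical edge is not a horizontal edge of its upper row (`y' ≠ y`). [folklore] -/
theorem vEdge_ne_hEdge {y' y : ℤ} (hy : y' ≠ y) (x x' : ℤ) : vEdge y' y x ≠ hEdge y x' := by
  intro h
  rw [vEdge, hEdge, Sym2.eq_iff] at h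
  rcases h with ⟨h, -⟩ | ⟨h, -⟩
  · have := congrFun h 1
    simp only [Matrix.cons_val_one, Matrix.cons_val_fin_one] at this
    exact hy this
  · have := congrFun h 1
    simp only [Matrix.cons_val_one, Matrix.cons_val_fin_one] at this
    exact hy this

/-- The edges drawn by the letter of row `y` over the columns `S'`: a vertical slot below every
column (towards row `y'`) and the horizontal edges inside the row. [folklore] -/
def rowEdges (S' : Finset ℤ) (y' y : ℤ) : Finset (Sym2 (Site 2)) :=
  (univ : Finset S').image (fun x : S' => vEdge y' y x) ∪ (hEdges S').image (fun x : S' => hEdge y x)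

/-- The edges encoded by a vertical configuration `O` and a horizontal configuration `H`.
[folklore] -/
def edgesOf (S' : Finset ℤ) (y' y : ℤ) (O H : Finset S') : Finset (Sym2 (Site 2)) :=
  O.image (fun x : S' => vEdge y' y x) ∪ H.image (fun x : S' => hEdge y x)

/-- `edgesOf O H ⊆ rowEdges` for `H ⊆ hEdges`. [folklore] -/
theorem edgesOf_subset_rowEdges (S' : Finset ℤ) (y' y : ℤ) (O H : Finset S')
    (hH : H ⊆ hEdges S') : edgesOf S' y' y O H ⊆ rowEdges S' y' y :=
  Finset.union_subset_union (Finset.image_subset_image (Finset.subset_univ O))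
    (Finset.image_subset_image hH)

/-- The row edges are edges of `ℤ²` (`y = y' + 1`). [folklore] -/
theorem rowEdges_subset_edgeSet (S' : Finset ℤ) (y' : ℤ) :
    ∀ e ∈ rowEdges S' y' (y' + 1), e ∈ (zdGraph 2).edgeSet := by
  have vec_add_single_one : ∀ x y : ℤ, (![x, y] : Site 2) + Pi.single 1 1 = ![x, y + 1] :=
    fun x y => by ext i; fin_cases i <;> simp
  have vec_add_single_zero : ∀ x y : ℤ, (![x, y] : Site 2) + Pi.single 0 1 = ![x + 1, y] :=
    fun x y => by ext i; fin_cases i <;> simp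
  intro e he
  unfold rowEdges at he
  rcases Finset.mem_union.1 he with he | he
  · obtain ⟨x, -, rfl⟩ := Finset.mem_image.1 he
    rw [vEdge, ← vec_add_single_one]
    exact single_edge_mem _ 1
  · obtain ⟨x, -, rfl⟩ := Finset.mem_image.1 he
    rw [hEdge, ← vec_add_single_zero]
    exact single_edge_mem _ 0

/-- The number of row edges: one vertical slot per column plus the horizontal edges
(`y' ≠ y`). [folklore] -/
theorem card_rowEdges (S' : Finset ℤ) {y' y : ℤ} (hy : y' ≠ y) :
    (rowEdges S' y' y).card = S'.card + (hEdges S').card := by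
  unfold rowEdges
  rw [Finset.card_union_of_disjoint, Finset.card_image_of_injective, Finset.card_image_of_injective,
    Finset.card_univ, Fintype.card_coe]
  · exact fun x x' h => Subtype.ext (hEdge_injective y h)
  · exact fun x x' h => Subtype.ext (vEdge_injective y' y h)
  · rw [Finset.disjoint_left]
    rintro e he he'
    obtain ⟨x, -, rfl⟩ := Finset.mem_image.1 he
    obtain ⟨x', -, h⟩ := Finset.mem_image.1 he'
    exact vEdge_ne_hEdge hy x x' h.symm

/-- Membership of a vertical slot in `edgesOf O H`. [folklore] -/
theorem vEdge_mem_edgesOf {S' : Finset ℤ} {y' y : ℤ} (hy : y' ≠ y) {O H : Finset S'} {x : S'} :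
    vEdge y' y x ∈ edgesOf S' y' y O H ↔ x ∈ O := by
  unfold edgesOf
  rw [Finset.mem_union, Finset.mem_image, Finset.mem_image]
  constructor
  · rintro (⟨x', hx', h⟩ | ⟨x', -, h⟩)
    · obtain rfl : x' = x := Subtype.ext (vEdge_injective y' y h)
      exact hx'
    · exact absurd h.symm (vEdge_ne_hEdge hy _ _)
  · exact fun h => Or.inl ⟨x, h, rfl⟩

/-- Membership of a horizontal edge in `edgesOf O H`. [folklore] -/
theorem hEdge_mem_edgesOf {S' : Finset ℤ} {y' y : ℤ} (hy : y' ≠ y) {O H : Finset S'} {x : S'} :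
    hEdge y x ∈ edgesOf S' y' y O H ↔ x ∈ H := by
  unfold edgesOf
  rw [Finset.mem_union, Finset.mem_image, Finset.mem_image]
  constructor
  · rintro (⟨x', -, h⟩ | ⟨x', hx', h⟩)
    · exact absurd h (vEdge_ne_hEdge hy _ _)
    · obtain rfl : x' = x := Subtype.ext (hEdge_injective y h)
      exact hx'
  · exact fun h => Or.inr ⟨x, h, rfl⟩

/-- **The edge configurations of one row are a cylinder event**: prescribing the open vertical
slots `O` and open horizontal edges `H ⊆ hEdges` of row `y` is the cylinder event of `rowEdges`
with pattern `edgesOf O H`. [folklore] -/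
theorem openVert_openHoriz_iff {S' : Finset ℤ} {y' y : ℤ} (hy : y' ≠ y) {O H : Finset S'}
    (hH : H ⊆ hEdges S') (ω : BondConfig (Site 2)) :
    (openVert ω S' y' y = O ∧ openHoriz ω S' y = H) ↔
      ω ∈ boxEvent (rowEdges S' y' y) (edgesOf S' y' y O H) := by
  rw [mem_boxEvent, rowEdges, Finset.forall_mem_union, Finset.forall_mem_image,
    Finset.forall_mem_image]
  simp only [Finset.mem_univ, true_implies, vEdge_mem_edgesOf hy, hEdge_mem_edgesOf hy]
  constructor
  · rintro ⟨rfl, rfl⟩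
    constructor
    · intro x
      simp [openVert]
    · intro x hx
      simp [openHoriz, hx]
  · rintro ⟨hO, hH'⟩
    constructor
    · ext x
      simp [openVert, @hO x]
    · ext x
      simp only [openHoriz, Finset.mem_filter]
      constructor
      · rintro ⟨hx, hxω⟩
        exact (hH' hx).1 hxω
      · intro hx
        exact ⟨hH hx, (hH' (hH hx)).2 hx⟩

/-- Cylinder events over disjoint edge sets intersect to a cylinder event. [folklore] -/
theorem boxEvent_inter {E₁ A₁ E₂ A₂ : Finset (Sym2 (Site 2))} (hd : Disjoint E₁ E₂) (h₁ : A₁ ⊆ E₁)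
    (h₂ : A₂ ⊆ E₂) : boxEvent E₁ A₁ ∩ boxEvent E₂ A₂ = boxEvent (E₁ ∪ E₂) (A₁ ∪ A₂) := by
  ext ω
  rw [Set.mem_inter_iff, mem_boxEvent, mem_boxEvent, mem_boxEvent, Finset.forall_mem_union]
  refine and_congr (forall₂_congr fun e he => ?_) (forall₂_congr fun e he => ?_)
  · have : e ∉ A₂ := fun h => Finset.disjoint_left.1 hd he (h₂ h)
    rw [Finset.mem_union]
    simp [this]
  · have : e ∉ A₁ := fun h => Finset.disjoint_left.1 hd (h₁ h) he
    rw [Finset.mem_union]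
    simp [this]

variable (V : Finset (Site 2)) (WA WB : Set (Site 2)) (b : ℤ)

/-- The edges drawn by the first `n` letters (rows `b + 1, …, b + n`). [folklore] -/
def pastEdges : ℕ → Finset (Sym2 (Site 2))
  | 0 => ∅
  | n + 1 => pastEdges n ∪ rowEdges (rowCols V (b + (n + 1 : ℕ))) (b + n) (b + (n + 1 : ℕ))

/-- `pastEdges` is increasing. [folklore] -/
theorem pastEdges_subset_succ (n : ℕ) : pastEdges V b n ⊆ pastEdges V b (n + 1) :=
  Finset.subset_union_left

/-- The past edges lie in the rows `≤ b + n`. [folklore] -/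
theorem pastEdges_low (n : ℕ) : ∀ e ∈ pastEdges V b n, ∀ v ∈ e, v 1 ≤ b + n := by
  induction n with
  | zero => simp [pastEdges]
  | succ n ih =>
    intro e he v hv
    rcases Finset.mem_union.1 he with he | he
    · have := ih e he v hv
      push_cast
      linarith
    · unfold rowEdges at he
      rcases Finset.mem_union.1 he with he | he
      · obtain ⟨x, -, rfl⟩ := Finset.mem_image.1 he
        rw [vEdge, Sym2.mem_iff] at hv
        rcases hv with rfl | rfl
        · simp
        · simp
      · obtain ⟨x, -, rfl⟩ := Finset.mem_image.1 he
        rw [hEdge, Sym2.mem_iff] at hv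
        rcases hv with rfl | rfl
        · simp
        · simp

/-- The edges of row `b + n + 1` are new. [folklore] -/
theorem disjoint_rowEdges_pastEdges (n : ℕ) :
    Disjoint (rowEdges (rowCols V (b + (n + 1 : ℕ))) (b + n) (b + (n + 1 : ℕ))) (pastEdges V b n) := by
  rw [Finset.disjoint_left]
  intro e he he'
  have hlow := pastEdges_low V b n e he'
  unfold rowEdges at he
  rcases Finset.mem_union.1 he with he | he
  · obtain ⟨x, -, rfl⟩ := Finset.mem_image.1 he
    have := hlow ![(x : ℤ), b + (n + 1 : ℕ)] (Sym2.mem_mk_right _ _)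
    simp only [Matrix.cons_val_one, Matrix.cons_val_fin_one] at this
    push_cast at this
    linarith
  · obtain ⟨x, -, rfl⟩ := Finset.mem_image.1 he
    have := hlow ![(x : ℤ), b + (n + 1 : ℕ)] (Sym2.mem_mk_left _ _)
    simp only [Matrix.cons_val_one, Matrix.cons_val_fin_one] at this
    push_cast at this
    linarith

/-! ### The law of the row state: induction over the rows -/

/-- The event "the state of row `b + n` is `π`". [folklore] -/
def partEvent (n : ℕ) (π : RowState₂ (rowCols V (b + n))) : Set (BondConfig (Site 2)) :=
  {ω | partRec V WA WB b ω n = π}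

/-- The state of row `b + n` together with the edge configuration of row `b + n + 1`.
[folklore] -/
def fiberMap (n : ℕ) (ω : BondConfig (Site 2)) :
    RowState₂ (rowCols V (b + n)) ×
      (Finset (rowCols V (b + (n + 1 : ℕ))) × Finset (rowCols V (b + (n + 1 : ℕ)))) :=
  (partRec V WA WB b ω n, (openVert ω (rowCols V (b + (n + 1 : ℕ))) (b + n) (b + (n + 1 : ℕ)),
    openHoriz ω (rowCols V (b + (n + 1 : ℕ))) (b + (n + 1 : ℕ))))

/-- Prescribing the open vertical slots is a measurable event. [folklore] -/
theorem measurableSet_openVert_eq (S' : Finset ℤ) (y' y : ℤ) (O : Finset S') :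
    MeasurableSet {ω : BondConfig (Site 2) | openVert ω S' y' y = O} := by
  have : {ω : BondConfig (Site 2) | openVert ω S' y' y = O} =
      ⋂ x : S', {ω | vEdge y' y x ∈ ω ↔ x ∈ O} := by
    ext ω
    simp only [Set.mem_setOf_eq, Set.mem_iInter, openVert, Finset.ext_iff, Finset.mem_filter,
      Finset.mem_univ, true_and]
  rw [this]
  exact MeasurableSet.iInter fun x => measurableSet_mem_iff _ _

/-- Prescribing the open horizontal edges is a measurable event. [folklore] -/
theorem measurableSet_openHoriz_eq (S' : Finset ℤ) (y : ℤ) (H : Finset S') :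
    MeasurableSet {ω : BondConfig (Site 2) | openHoriz ω S' y = H} := by
  have : {ω : BondConfig (Site 2) | openHoriz ω S' y = H} =
      ⋂ x : S', {ω | (x ∈ hEdges S' ∧ hEdge y x ∈ ω) ↔ x ∈ H} := by
    ext ω
    simp only [Set.mem_setOf_eq, Set.mem_iInter, openHoriz, Finset.ext_iff, Finset.mem_filter]
  rw [this]
  refine MeasurableSet.iInter fun x => ?_
  by_cases hx : x ∈ hEdges S'
  · have : {ω : BondConfig (Site 2) | (x ∈ hEdges S' ∧ hEdge y x ∈ ω) ↔ x ∈ H} =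
        {ω | hEdge y x ∈ ω ↔ x ∈ H} := by
      ext ω; simp [hx]
    rw [this]
    exact measurableSet_mem_iff _ _
  · have : {ω : BondConfig (Site 2) | (x ∈ hEdges S' ∧ hEdge y x ∈ ω) ↔ x ∈ H} =
        {_ω | False ↔ x ∈ H} := by
      ext ω; simp [hx]
    rw [this]
    exact MeasurableSet.const _

/-- One step of the recursion through the fiber map. [folklore] -/
theorem partRec_succ (ω : BondConfig (Site 2)) (n : ℕ) :
    partRec V WA WB b ω (n + 1) =
      rowMap (rowCols V (b + n)) (rowCols V (b + (n + 1 : ℕ)))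
        (rowWires WA _ (b + (n + 1 : ℕ))) (rowWires WB _ (b + (n + 1 : ℕ)))
        (fiberMap V WA WB b n ω).2.1 (fiberMap V WA WB b n ω).2.2 (fiberMap V WA WB b n ω).1 :=
  rfl

/-- The events `partEvent n π` are measurable. [folklore] -/
theorem measurableSet_partEvent (n : ℕ) :
    ∀ π : RowState₂ (rowCols V (b + n)), MeasurableSet (partEvent V WA WB b n π) := by
  induction n with
  | zero =>
    intro π
    change MeasurableSet {_ω : BondConfig (Site 2) | RowState₂.free (rowCols V (b + (0 : ℕ))) = π}
    exact MeasurableSet.const _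
  | succ n ih =>
    intro π'
    have : partEvent V WA WB b (n + 1) π' =
        ⋃ t ∈ (univ.filter fun t : RowState₂ (rowCols V (b + n)) ×
            (Finset (rowCols V (b + (n + 1 : ℕ))) × Finset (rowCols V (b + (n + 1 : ℕ)))) =>
            rowMap (rowCols V (b + n)) (rowCols V (b + (n + 1 : ℕ)))
              (rowWires WA _ (b + (n + 1 : ℕ))) (rowWires WB _ (b + (n + 1 : ℕ)))
              t.2.1 t.2.2 t.1 = π'),
          fiberMap V WA WB b n ⁻¹' {t} := by
      ext ω
      simp only [partEvent, Set.mem_setOf_eq, Set.mem_iUnion, Set.mem_preimage,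
        Set.mem_singleton_iff, Finset.mem_filter, Finset.mem_univ, true_and, exists_prop]
      constructor
      · intro h
        exact ⟨fiberMap V WA WB b n ω, h, rfl⟩
      · rintro ⟨t, ht, rfl⟩
        exact ht
    rw [this]
    refine Finset.measurableSet_biUnion _ fun t _ => ?_
    have : fiberMap V WA WB b n ⁻¹' {t} = partEvent V WA WB b n t.1 ∩
        ({ω | openVert ω (rowCols V (b + (n + 1 : ℕ))) (b + n) (b + (n + 1 : ℕ)) = t.2.1} ∩
          {ω | openHoriz ω (rowCols V (b + (n + 1 : ℕ))) (b + (n + 1 : ℕ)) = t.2.2}) := by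
      ext ω
      simp only [Set.mem_preimage, Set.mem_singleton_iff, fiberMap, Prod.ext_iff, partEvent,
        Set.mem_inter_iff, Set.mem_setOf_eq]
    rw [this]
    exact (ih _).inter ((measurableSet_openVert_eq _ _ _ _).inter
      (measurableSet_openHoriz_eq _ _ _))

/-- The fibers of the fiber map are measurable. [folklore] -/
theorem measurableSet_fiberMap (n : ℕ)
    (t : RowState₂ (rowCols V (b + n)) ×
      (Finset (rowCols V (b + (n + 1 : ℕ))) × Finset (rowCols V (b + (n + 1 : ℕ))))) :
    MeasurableSet (fiberMap V WA WB b n ⁻¹' {t}) := by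
  have : fiberMap V WA WB b n ⁻¹' {t} = partEvent V WA WB b n t.1 ∩
      ({ω | openVert ω (rowCols V (b + (n + 1 : ℕ))) (b + n) (b + (n + 1 : ℕ)) = t.2.1} ∩
        {ω | openHoriz ω (rowCols V (b + (n + 1 : ℕ))) (b + (n + 1 : ℕ)) = t.2.2}) := by
    ext ω
    simp only [Set.mem_preimage, Set.mem_singleton_iff, fiberMap, Prod.ext_iff, partEvent,
      Set.mem_inter_iff, Set.mem_setOf_eq]
  rw [this]
  exact (measurableSet_partEvent V WA WB b n _).inter ((measurableSet_openVert_eq _ _ _ _).inter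
    (measurableSet_openHoriz_eq _ _ _))

/-- **The law of the row state, with a spectator cylinder event.** For every finite set `E'` of
edges of `ℤ²` not drawn by the first `n` letters and every `A' ⊆ E'`,
`P_{1/2}(state of row b + n = π, ω ∩ E' = A') = latticeWordDist n π · 2^{-|E'|}`: the finite
Markov bookkeeping row by row (independence entering only through the cylinder formula
`prob_boxEvent`). [folklore] -/
theorem prob_partEvent_inter_boxEvent (n : ℕ) :
    ∀ (E' A' : Finset (Sym2 (Site 2))), Disjoint E' (pastEdges V b n) →
      (∀ e ∈ E', e ∈ (zdGraph 2).edgeSet) → A' ⊆ E' → ∀ π : RowState₂ (rowCols V (b + n)),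
      (bondPercolation (zdGraph 2) half).real (partEvent V WA WB b n π ∩ boxEvent E' A') =
        latticeWordDist V WA WB b n π * (1 / 2 : ℝ) ^ E'.card := by
  induction n with
  | zero =>
    intro E' A' _ hE' _ π
    have h0 : latticeWordDist V WA WB b 0 π = rowInit₂ _ π := rfl
    by_cases hπ : RowState₂.free (rowCols V (b + (0 : ℕ))) = π
    · have : partEvent V WA WB b 0 π = Set.univ := by
        ext ω; simpa [partEvent, partRec] using hπ
      rw [this, Set.univ_inter, prob_boxEvent E' A' hE', h0]
      subst hπ
      simp [rowInit₂]
    · have : partEvent V WA WB b 0 π = ∅ := by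
        ext ω; simpa [partEvent, partRec] using hπ
      rw [this, Set.empty_inter, measureReal_empty, h0]
      simp only [rowInit₂]
      rw [if_neg (Ne.symm hπ), zero_mul]
  | succ n ih =>
    intro E' A' hdis hE' hA' π'
    -- notation
    set P := bondPercolation (zdGraph 2) half with hP
    set Rw := rowEdges (rowCols V (b + (n + 1 : ℕ))) (b + n) (b + (n + 1 : ℕ)) with hRw
    have hy : (b + n : ℤ) ≠ b + (n + 1 : ℕ) := by push_cast; linarith
    set sidx := (univ : Finset (RowState₂ (rowCols V (b + n)))) ×ˢ
      ((univ : Finset (Finset (rowCols V (b + (n + 1 : ℕ))))) ×ˢ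
        (hEdges (rowCols V (b + (n + 1 : ℕ)))).powerset) with hsidx
    -- disjointness bookkeeping
    have hRw_dis : Disjoint Rw (pastEdges V b n) := disjoint_rowEdges_pastEdges V b n
    have hE'_dis_n : Disjoint E' (pastEdges V b n) :=
      hdis.mono_right (pastEdges_subset_succ V b n)
    have hRwE' : Disjoint Rw E' := by
      have : Rw ⊆ pastEdges V b (n + 1) := Finset.subset_union_right
      exact (hdis.mono_right this).symm
    have hunion_dis : Disjoint (Rw ∪ E') (pastEdges V b n) :=
      Finset.disjoint_union_left.2 ⟨hRw_dis, hE'_dis_n⟩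
    have hunion_edge : ∀ e ∈ Rw ∪ E', e ∈ (zdGraph 2).edgeSet := by
      intro e he
      rcases Finset.mem_union.1 he with he | he
      · have e1 : b + (n + 1 : ℕ) = b + n + 1 := by push_cast; ring
        rw [hRw, e1] at he
        exact rowEdges_subset_edgeSet _ _ e he
      · exact hE' e he
    -- total probability over the fibers
    have hstep1 : P.real (partEvent V WA WB b (n + 1) π' ∩ boxEvent E' A') =
        ∑ t ∈ sidx, P.real (fiberMap V WA WB b n ⁻¹' {t} ∩
          (partEvent V WA WB b (n + 1) π' ∩ boxEvent E' A')) := by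
      have hcover : fiberMap V WA WB b n ⁻¹' (↑sidx) = Set.univ := by
        ext ω
        simp only [Set.mem_preimage, Finset.coe_product, Finset.coe_univ, Set.mem_prod,
          Set.mem_univ, true_and, Finset.coe_powerset, Set.mem_powerset_iff,
          Finset.coe_subset, iff_true, fiberMap, hsidx, Set.mem_univ]
        exact Finset.filter_subset _ _
      have h1 : (P.restrict (partEvent V WA WB b (n + 1) π' ∩ boxEvent E' A')).real
          (fiberMap V WA WB b n ⁻¹' ↑sidx) =
          ∑ t ∈ sidx, (P.restrict (partEvent V WA WB b (n + 1) π' ∩ boxEvent E' A')).real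
            (fiberMap V WA WB b n ⁻¹' {t}) :=
        (sum_measureReal_preimage_singleton sidx
          (fun t _ => measurableSet_fiberMap V WA WB b n t)).symm
      rw [hcover, measureReal_restrict_apply MeasurableSet.univ, Set.univ_inter] at h1
      rw [h1]
      refine Finset.sum_congr rfl fun t _ => ?_
      exact measureReal_restrict_apply (measurableSet_fiberMap V WA WB b n t)
    -- each fiber
    have hstep2 : ∀ t ∈ sidx, P.real (fiberMap V WA WB b n ⁻¹' {t} ∩
        (partEvent V WA WB b (n + 1) π' ∩ boxEvent E' A')) =
        if rowMap (rowCols V (b + n)) (rowCols V (b + (n + 1 : ℕ)))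
            (rowWires WA _ (b + (n + 1 : ℕ))) (rowWires WB _ (b + (n + 1 : ℕ)))
            t.2.1 t.2.2 t.1 = π' then
          latticeWordDist V WA WB b n t.1 * (1 / 2 : ℝ) ^ (Rw.card + E'.card) else 0 := by
      rintro ⟨π, O, H⟩ ht
      dsimp only
      have hH : H ⊆ hEdges (rowCols V (b + (n + 1 : ℕ))) := by
        simp only [hsidx, Finset.mem_product, Finset.mem_univ, true_and,
          Finset.mem_powerset] at ht
        exact ht
      have hfib : fiberMap V WA WB b n ⁻¹' {(π, O, H)} =
          partEvent V WA WB b n π ∩ boxEvent Rw (edgesOf _ (b + n) (b + (n + 1 : ℕ)) O H) := by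
        ext ω
        simp only [Set.mem_preimage, Set.mem_singleton_iff, fiberMap, Prod.ext_iff,
          Set.mem_inter_iff, partEvent, Set.mem_setOf_eq]
        rw [← openVert_openHoriz_iff hy hH ω]
      -- on the fiber, the new state is `rowMap O H π`
      have hval : ∀ ω ∈ fiberMap V WA WB b n ⁻¹' {(π, O, H)},
          partRec V WA WB b ω (n + 1) = rowMap (rowCols V (b + n)) (rowCols V (b + (n + 1 : ℕ)))
            (rowWires WA _ (b + (n + 1 : ℕ))) (rowWires WB _ (b + (n + 1 : ℕ))) O H π := by
        intro ω hω
        simp only [Set.mem_preimage, Set.mem_singleton_iff, fiberMap, Prod.ext_iff] at hω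
        obtain ⟨e1, e2, e3⟩ := hω
        rw [partRec_succ]
        simp only [fiberMap]
        rw [e1, e2, e3]
      split_ifs with hmap
      · have hset : fiberMap V WA WB b n ⁻¹' {(π, O, H)} ∩
            (partEvent V WA WB b (n + 1) π' ∩ boxEvent E' A') =
            partEvent V WA WB b n π ∩
              boxEvent (Rw ∪ E') (edgesOf _ (b + n) (b + (n + 1 : ℕ)) O H ∪ A') := by
          rw [← boxEvent_inter hRwE' (edgesOf_subset_rowEdges _ _ _ O H hH) hA']
          conv_rhs => rw [← Set.inter_assoc, ← hfib]
          ext ω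
          simp only [Set.mem_inter_iff]
          constructor
          · rintro ⟨h1, -, h3⟩
            exact ⟨h1, h3⟩
          · rintro ⟨h1, h3⟩
            exact ⟨h1, (hval ω h1).trans hmap, h3⟩
        rw [hset, ih (Rw ∪ E') _ hunion_dis hunion_edge
          (Finset.union_subset_union (edgesOf_subset_rowEdges _ _ _ O H hH) hA') π,
          Finset.card_union_of_disjoint hRwE']
      · have hset : fiberMap V WA WB b n ⁻¹' {(π, O, H)} ∩
            (partEvent V WA WB b (n + 1) π' ∩ boxEvent E' A') = ∅ := by
          ext ω
          simp only [Set.mem_inter_iff, Set.mem_empty_iff_false, iff_false]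
          rintro ⟨h1, h2, -⟩
          exact hmap ((hval ω h1).symm.trans h2)
        rw [hset, measureReal_empty]
    -- summation
    rw [hstep1, Finset.sum_congr rfl hstep2]
    change _ = rowLetter (rowCols V (b + n)) (rowCols V (b + (n + 1 : ℕ)))
      (rowWires WA _ (b + (n + 1 : ℕ))) (rowWires WB _ (b + (n + 1 : ℕ)))
      (latticeWordDist V WA WB b n) π' * (1 / 2 : ℝ) ^ E'.card
    rw [rowLetter_apply, hsidx, Finset.sum_product, hRw, card_rowEdges _ hy]
    simp only [Finset.sum_product, pow_add]
    rw [Finset.sum_comm]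
    simp only [Finset.mul_sum, Finset.sum_mul]
    refine Finset.sum_congr rfl fun O _ => ?_
    rw [Finset.sum_comm]
    refine Finset.sum_congr rfl fun H _ => Finset.sum_congr rfl fun π _ => ?_
    split_ifs
    · rw [one_div_pow, one_div_pow, one_div_pow]
      field_simp
    · simp

/-- **The law of the row state**: `P_{1/2}(state of row b + n = π) = latticeWordDist n π`.
[folklore] -/
theorem prob_partEvent (n : ℕ) (π : RowState₂ (rowCols V (b + n))) :
    (bondPercolation (zdGraph 2) half).real (partEvent V WA WB b n π) =
      latticeWordDist V WA WB b n π := by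
  have h := prob_partEvent_inter_boxEvent V WA WB b n ∅ ∅ (Finset.disjoint_empty_left _)
    (by simp) (Finset.empty_subset _) π
  have hbox : boxEvent ∅ ∅ = Set.univ := by
    ext ω; simp [boxEvent]
  rw [hbox, Set.inter_univ] at h
  simpa using h

/-- **The probability that the stars are joined after `n` rows is the word amplitude.**
[folklore] -/
theorem prob_starsJoined (n : ℕ) :
    (bondPercolation (zdGraph 2) half).real {ω | (partRec V WA WB b ω n).StarsJoined} =
      latticeWordAmplitude V WA WB b n := by
  set P := bondPercolation (zdGraph 2) half with hP
  have hset : {ω | (partRec V WA WB b ω n).StarsJoined} =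
      (fun ω => partRec V WA WB b ω n) ⁻¹' ↑(univ.filter fun π : RowState₂ (rowCols V (b + n)) =>
        π.StarsJoined) := by
    ext ω
    simp
  rw [hset, ← sum_measureReal_preimage_singleton _
    (fun π _ => measurableSet_partEvent V WA WB b n π), Finset.sum_filter, latticeWordAmplitude]
  refine Finset.sum_congr rfl fun π _ => ?_
  unfold rowReadout₂
  split_ifs with h
  · rw [mul_one]
    exact prob_partEvent V WA WB b n π
  · rw [mul_zero]

end Probability

/-! ### The crossing event of a lattice polygon at an aligned mesh -/

section Polygon

variable {δ₀ : ℝ} {s : Finset (ℤ × ℤ)} {N : ℕ}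

/-- **The crossing event is "stars joined" at the top row.** For the open polyomino of `s` at
the aligned mesh `δ₀ / N`, G02's crossing event `discreteCrossing` between the discrete arcs of
`A` and `B` is the event that the two stars are joined in the recursively computed state of the
top row of `Ω_δ` (wires: the two discrete arcs). [folklore] -/
theorem discreteCrossing_polyomino_eq (hδ₀ : 0 < δ₀) (hN : 0 < N)
    (hbdd : Bornology.IsBounded (polyominoCarrier δ₀ s)) (A B : Set ℂ) :
    discreteCrossing (polyominoCarrier δ₀ s) (δ₀ / N) A B =
      {ω | (partRec (meshDomainFinset (polyominoCarrier δ₀ s) (δ₀ / N))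
        (discreteArc (polyominoCarrier δ₀ s) (δ₀ / N) A)
        (discreteArc (polyominoCarrier δ₀ s) (δ₀ / N) B)
        (wordBaseRow (meshDomainFinset (polyominoCarrier δ₀ s) (δ₀ / N))) ω
        (wordRowCount (meshDomainFinset (polyominoCarrier δ₀ s) (δ₀ / N)))).StarsJoined} := by
  set Ω := polyominoCarrier δ₀ s with hΩ
  set V := meshDomainFinset Ω (δ₀ / N) with hVdef
  set WA := discreteArc Ω (δ₀ / N) A with hWA
  set WB := discreteArc Ω (δ₀ / N) B with hWB
  have hδ : (0 : ℝ) < δ₀ / N := div_pos hδ₀ (by exact_mod_cast hN)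
  have hV : ∀ v, v ∈ V ↔ v ∈ meshDomain Ω (δ₀ / N) := fun v => by
    rw [← Finset.mem_coe, hVdef, coe_meshDomainFinset hbdd hδ]
  have hrows : ∀ v ∈ V, wordBaseRow V < v 1 ∧ v 1 ≤ wordBaseRow V + wordRowCount V :=
    fun v hv => wordBaseRow_lt_and_le hv
  have hWAV : ∀ x ∈ WA, x ∈ V := fun x hx =>
    (hV x).2 (meshBoundary_subset_meshDomain _ _ (discreteArc_subset_meshBoundary _ _ _ hx))
  have hWBV : ∀ x ∈ WB, x ∈ V := fun x hx =>
    (hV x).2 (meshBoundary_subset_meshDomain _ _ (discreteArc_subset_meshBoundary _ _ _ hx))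
  ext ω
  have hG : siteGraph V ω = openGraph ω ⊓ discreteDomainGraph Ω (δ₀ / N) := by
    ext u v
    rw [siteGraph_adj, SimpleGraph.inf_adj, openGraph_adj, hΩ,
      discreteDomainGraph_adj_iff_polyomino hδ₀ hN, ← hΩ, ← hV, ← hV]
    constructor
    · rintro ⟨hu, hv, hadj, he⟩
      exact ⟨⟨he, hadj.ne⟩, hadj, hu, hv⟩
    · rintro ⟨⟨he, -⟩, hadj, hu, hv⟩
      exact ⟨hu, hv, hadj, he⟩
  have hstars : (partRec V WA WB (wordBaseRow V) ω (wordRowCount V)).StarsJoined ↔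
      augRel V WA WB (wordBaseRow V) ω (wordRowCount V) (Sum.inr 0) (Sum.inr 1) := by
    change (partRec V WA WB (wordBaseRow V) ω (wordRowCount V)).rel _ _ ↔ _
    rw [partRec_rel]
    rfl
  rw [mem_discreteCrossing_iff, Set.mem_setOf_eq, hstars, augRel_iff_reachable WA WB hrows ω,
    reachable_stars_iff, hG]
  constructor
  · rintro ⟨x, hx, y, hy, h⟩
    exact ⟨x, hx, hWAV x hx, y, hy, hWBV y hy, h⟩
  · rintro ⟨x, hx, -, y, hy, -, h⟩
    exact ⟨x, hx, y, hy, h⟩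

end Polygon

end RowTransfer

/-- **Row-transfer exactness holds** (discharge of the named fact `RowTransferExactness`): for a
conformal rectangle whose carrier is an open polyomino of `δ₀`-squares, at every aligned mesh
`δ = δ₀ / N` the G02 crossing probability of bond percolation on `ℤ²` at `p = 1/2` equals the
transfer-matrix word amplitude, `bondDomainCrossingProb R δ = polygonWordAmplitude R δ`.
Proof: `Ω_δ` is the subgraph of `ℤ²` induced on `meshDomain` (`discreteDomainGraph_adj_iff_polyomino`);
the two-star state of row `y` computed from `ω` by restrict–insert–vertical–horizontal–wire is the
partition of row `y ⊔ {⋆_A, ⋆_B}` induced by the open edges and wires of the rows `≤ y`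
(`RowTransfer.partRec_rel`), whence the crossing event is "stars joined" at the top
(`RowTransfer.discreteCrossing_polyomino_eq`); and its law is the word's running distribution
(`RowTransfer.prob_partEvent`, finite Markov bookkeeping with the cylinder marginal
`RowTransfer.prob_boxEvent` of `P_{1/2}`). The finite-lattice form of "the crossing probability is
a matrix element of a product of transfer matrices between boundary states" (Cardy,
arXiv:math-ph/0103018, §7.1; Bondesan–Jacobsen–Saleur, arXiv:1207.7005, §5). [folklore] -/
theorem RowTransferExactness_holds : RowTransferExactness := by
  intro R δ₀ s N hδ₀ hN hcar
  rw [Percolation.bondDomainCrossingProb_eq_measureReal, polygonWordAmplitude,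
    latticeCrossingAmplitude, hcar]
  have hbdd : Bornology.IsBounded (polyominoCarrier δ₀ s) := hcar ▸ R.isBounded
  rw [RowTransfer.discreteCrossing_polyomino_eq hδ₀ hN hbdd, RowTransfer.prob_starsJoined]


end Literature.Probability.LatticeModels

end
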